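/-
Copyright: statement-level skeleton of a published paper (lit-balaban cell, Phase-2 proof seat p39 gen 26). No proof claims
beyond what the kernel checks below.
-/
import Literature.MathematicalPhysics.QuantumFieldTheory.Balaban1983to89.B3Eq122ChargeWick
import Literature.MathematicalPhysics.QuantumFieldTheory.Balaban1983to89.B1Eq362TaylorRemainder
import Literature.Analysis.FunctionSpaces.SmoothParametricIntegralWithin
import Literature.Analysis.Calculus.MixedPartialDerivWithin
import Literature.Analysis.Calculus.TaylorSegmentWithin

/-!
# Bałaban, *(Higgs)₂,₃ quantum fields in a finite volume. III*, CMP 88 (1983) [Balaban1983Higgs3], pp. 416–417: THE TWO-POINT FUNCTION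
# (1.19) OF THE ACTION (1.20), WITH THE COUNTERTERM `δm² = δm²(e,λ)` INSERTED, IS JOINTLY SMOOTH IN THE TWO EXPANSION PARAMETERS
# `(e, λ)` — `λ ≥ 0` one-sided —, ALL DERIVATIVES OBTAINED BY DIFFERENTIATING UNDER `∫dA dφ`; its mixed partials
# `∂^α_e∂^β_λG^ε(0,0⁺)` exist for EVERY index `(α,β)` and commute, and (1.19) has its two-variable Taylor formula with remainder to every
# order: print's *"G^ε has a perturbative expansion"* / *"expanded into power series in e, λ"* as a regularity theorem about the measure

statement-level skeleton of published theorems with citation tags; proofs where landed; nothing here is a claim about the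
Yang–Mills mass gap.

[cite: Balaban1983Higgs3, (1.19)–(1.21) p.416 (PDF 6), (1.23) and the preceding paragraph p.417 (PDF 7)].  Unit `lit-balaban-p39-g26`
(Phase-2 proof seat p39, gen 26), free-target protocol G.5-34(d), zero head weight: BRICK 11 of the optional target named in r15's HEAD
QUESTION 25 — rows **B3.Eq1.19-1.22** and **B3.Eq1.23** of `HOME/lit-balaban-r15/ROWS-B3.md` (owner r15, heads `proved`), OPTIONAL
LOCATED MEMBER of the (1.19)/(1.21) and (1.23) cells; TAKING HOME/STATUS 2026-08-23T23:58Z, owner r15 g17 «WELCOME, NO OBJECTION»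
23:59Z (with the two docstring notes honoured below: weight 4 = EXISTENCE only; weight 3 in referee D-g79-2's wording).  Sibling bricks
(disjoint, cited not imported): BRICK 7 `B3Eq122ChargeWick` (this seat, gen 23: the carrier — IMPORTED), BRICK 8 `B3Eq122MassInsertionWick`,
BRICK 10 `B3Eq123RenormalizationConditions` (this seat, gens 24–25: orders `e²`, `e²δm²`, `λ`, weight 3 by reflection; its joint family
is this file's `twoPtCt` verbatim, `twoPtCt_eq`), BRICKS 4–6/9 `B3TwoPointPerturbativeCoefficients` / `B3Eq119*` (p33: the expansion in
the NUMBER of vertices, one-sided in the tilt `t`), BRICKS 2–3 (p32/p37: 1PI chains).  GENERIC ENGINES CONSUMED BY NAME (the typer's, for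
the analogous statement about the auxiliary function `E_k(e′,λ′)` of (1.4)/(1.5): `B3Eq14TotalExponent`, `B3Eq15JointSmooth`,
`B3Eq15MixedPartials`, `B3Eq15TaylorRemainder`): `Literature.Analysis.FunctionSpaces.SmoothParametricIntegralWithin` ([Folland1999]
Thm 2.27 iterated within a convex parameter set), `Literature.Analysis.Calculus.MixedPartialDerivWithin` and `TaylorSegmentWithin`
([Coleman2012] §4.5, Thm 4.3, Thm 5.3), Mathlib's `norm_iteratedFDeriv_comp_le` (Faà di Bruno bound).

PDF held: `paper:balaban1983-higgs-2-3-quantum-fields-finite-volume` (journal page = PDF page + 410); pp. 416–417 read on the ×2 renders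
`run/shared/lean/pub/pub-balaban/b2b-balaban-ref1/pages/1983-cmp88-higgs23-III/1983-cmp88-higgs23-III-p006-x2.png`, `…-p007-x2.png`.

THE PRINTED TEXT (verbatim).  P. 416: *"G^ε_{ab}(x,x′) = ⟨φ_a(x)φ_b(x′)⟩^ε = (Z^ε)^{−1}∫dA∫dφ e^{−S^ε(A,φ)}φ_a(x)φ_b(x′), x, x′ ∈ T_ε, (1.19)
where S^ε(A,φ) is the lattice action of the model given by S^ε(A,φ) = ½⟨φ,(−Δ^ε_A + m²)φ⟩ + Σ_{x∈T_ε}ε^d(λ∣φ(x)∣⁴ + ½δm²∣φ(x)∣²) +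
½⟨A,(−Δ^ε + μ₀²)A⟩, (1.20) and Z^ε is the partition function. The function G^ε has a perturbative expansion of the following structure
G^ε = Σ_{n=0}^∞ C₀^ε[(−δm² + Σ^ε + ∂^{ε*}Σ₁^ε + Σ₁^{ε*}∂^ε + ∂^{ε*}Σ₂^ε∂^ε)C₀^ε]ⁿ, (1.21)"*.  P. 417: *"This equation can be solved
recursively if δm² and Σ^ε are expanded into power series in e, λ … we write δm² = Σ_{2≤α+2β≤4}e^αλ^βδm²_{(α,β)} and we insert this
into Σ^ε … The counterterms δm²_{(α,β)} are defined by the equations −δm²_{(α,β)} + Σ_{x∈T_ε}ε^dΣ^ε_{(α,β)}(x) = 0"*.  The expansion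
of `G^ε` in the TWO parameters `e, λ`, with the counterterm itself a function of `(e, λ)` inserted in the action, is what these sentences
take for granted; this file proves that, on the finite lattice, it exists as the Taylor expansion of a jointly smooth function.

THE SETTING (BRICK 7's, [cite: Balaban1983Higgs3, (1.19)–(1.20) p.416]).  The model torus `T^{(j)}_η`, scalar fields `φ : T → ℝ^N`,
the vector field in components `A : T → ℝ^d` (`toVec`), `η^d = w`, `c = η⁻¹`, the joint weight `J_{e,M}(A,φ) =
e^{−½⟨A,(−Δ^η+μ₀²)A⟩}e^{−½⟨φ,(−Δ^η_{A,e}+M)φ⟩}` (`B3Eq122ChargeWick.J` at scalar mass `M`; the counterterm of (1.20) is a mass shift,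
`M = m² + δm²`), the legs `φ_a(x)φ_b(x′)` (`legs`).  NEW OBJECTS (definitions with bodies): the quartic interaction
`V(φ) = Σ_yη^d∣φ(y)∣⁴` (`V4`), the INTEGRAND `fibre ct F (e,λ) (A,φ) = J_{e, m²+ct(e,λ)}(A,φ)·e^{−λV(φ)}·F(φ)` of (1.19)/(1.20) as a
function of the PAIR `p = (e,λ)` for a counterterm FUNCTION `ct : ℝ → ℝ → ℝ`, its total exponent `texp` (and constant part `texp0`), the
charge path of one bond transport `uCe` (`e ↦ U(ηeA_b)v = exp(ηeA_b·q)v`), the two-point function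
**`twoPtCt ct (e,λ) a b x x′ = ∫fibre ct (φ_aφ_b) / ∫fibre ct 1`** = `G^{ct}_{ab}(e,λ;x,x′)` — BRICK 10's joint family VERBATIM
(`twoPtCt_eq`), BRICK 7's `twoPt` its `ct = 0, λ = 0` slice (`twoPtCt_zero_zero`) —, and two bookkeeping constants `Khop`, `growK`.
THE PARAMETER SET is a slab `I ×ˢ Λ ⊆ ℝ²`: `I` (charges) and `Λ ⊆ [0,∞)` (quartic couplings) convex, `Λ` of unique differentiability
(`[0,∞)`, `[0,δ]`), `I` open where slices are taken; the standing hypotheses are `η^d > 0`, `μ₀² > 0`, `ct` jointly `C^n`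
(`ContDiff ℝ n (fun p => ct p.1 p.2)`, `n ≤ ∞`) and POSITIVITY OF THE RUNNING MASS `m² + ct(e,λ) > 0` ON THE SLAB (for print's
truncated polynomial counterterm this holds on a slab around `(0,0)`, which is all a Taylor expansion at `(0,0⁺)` needs; for `ct = 0` it is
`m² > 0` on all of `ℝ × [0,∞)`).

THE ARGUMENT (ours; print's sentences are formal perturbation theory).  (§1–§2) The charge enters the action only through the bond
transports `U(ηeA_b) = exp(ηeA_b·q)` (BRICK 7 `quadForm_eq`), which are unitary with `‖q‖ ≤ 1` (B1 p. 605), so along `e` every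
derivative of a hopping term `⟪φ(b₋),U(ηeA_b)φ(b₊)⟫` is bounded by `∣φ(b₋)∣∣φ(b₊)∣(∣η∣∣A_b∣)ⁱ` UNIFORMLY IN `e`; the exponent
`W(e,λ;A,φ) = ½⟨φ,(−Δ^η_{A,e}+m²+ct(e,λ))φ⟩ + λV(φ)` is affine in `λ` and enters `ct` only through the mass term, hence on the closed
unit ball around any `(e₀,λ₀)`: `‖Dⁱ_{(e,λ)}W‖ ≤ B(1+sup∣φ∣²)²(1+∣η∣sup∣A∣)ⁱ` (`norm_iteratedFDeriv_texp_le`), and by Faà di Bruno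
(`norm_iteratedFDeriv_comp_le` for `u ↦ e^{−u}`) **`‖Dⁱ_{(e,λ)}[e^{−S^ε}e^{−λV}F]‖ ≤ i!·max(1,B(1+sup∣φ∣²)²(1+∣η∣sup∣A∣)^m)ⁱ·∣e^{−S^ε}e^{−λV}F∣`**
(`norm_iteratedFDeriv_fibre_le`).  (§3) On the slab near `(e₀,λ₀)` the running mass is `≥ m₀ > 0` (continuity), `e^{−λV} ≤ 1`, and
BRICK 7's Gaussian majorant `e^{−½⟨φ,(−Δ^η_A+M)φ⟩} ≤ e^{−(Mη^d/2)Σ∣φ∣²}` absorbs the polynomial weight (`1+t² ≤ 2e^t`): ONE integrable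
product majorant `[W_A(A)e^{m²∣η∣sup∣A∣}]·[e^{(2m+κ)sup∣φ∣}e^{−(m₀η^d/2)Σ∣φ∣²}]` dominates all parameter derivatives of order `≤ m`
(`exists_fibre_majorant`).  (§4) The typer's within-a-convex-set form of differentiation under the integral sign to all orders gives the
Taylor series of `p ↦ ∫fibre ct F p` WITHIN the slab (`hasFTaylorSeriesUpToOn_integral_fibre`); (§5) the partition function is positive, so
the quotient `G^{ct}` is jointly `C^n` (`contDiffOn_twoPtCt`).  (§6) Slices and mixed partials within `I ×ˢ Λ` with `I` OPEN: since
v1.2 the tree's `MixedPartialDerivWithin` §6 (`…_openFst`: `iteratedDeriv_iteratedDerivWithin_slice_eq_append_openFst`,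
`iteratedDeriv_iteratedDerivWithin_comm_openFst`, `contDiffOn_iteratedDerivWithin_slice_openFst`) BY NAME — v1.0/v1.1 carried these
as file-local lemmas (the tree's file then treated `univ ×ˢ I` only); this seat made them public and general there (gen 31, at the
typer's request, p383793 ✓) and v1.2 deletes the copies; the file-local `taylor_slab` (Taylor–Lagrange along the segment within the
slab plus the binomial expansion of the symmetric `Dⁱ` on `e(1,0) + λ(0,1)`) is since v1.3 a wrapper of this seat's public
`Literature.Analysis.Calculus.taylor_lagrange_mixed_partials_openFst` (`TaylorSegmentWithin` v1.1, p383971 ✓) at the base point `(0,0)`.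

WHAT IS PROVED (theorems; 0 `sorry`; no `Prop`-valued fact; axioms `propext`/`Classical.choice`/`Quot.sound` on every declaration checked).
* §1 `uCe`, `hasDerivAt_uCe`, **`iteratedDeriv_uCe`** (`∂ⁱ_eU(ηea)v = (ηa·q)ⁱU(ηea)v`), `contDiff_uCe`, **`norm_iteratedDeriv_uCe_le`** /
  `norm_iteratedFDeriv_uCe_le` (`≤ (∣η∣∣a∣)ⁱ∣v∣`).
* §2 `V4`, **`fibre`**, `fibre_apply` (BRICK 10's spelling), `texp0`, **`texp`**, `texp_eq_quadForm`, **`fibre_eq_exp`**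
  (`fibre = (W_A·F)·e^{−W}`), `contDiff_texp`, **`contDiff_fibre`**, `continuous_fibre_field`, **`norm_iteratedFDeriv_texp_le`** / `…_le'`,
  **`norm_iteratedFDeriv_fibre_le`** (Faà di Bruno).
* §3 `integrable_majorant'`, **`exists_fibre_majorant`**.
* §4 `aestronglyMeasurable_iteratedFDeriv_fibre`, **`hasFTaylorSeriesUpToOn_integral_fibre`**, **`contDiffOn_integral_fibre`**,
  **`iteratedFDerivWithin_integral_fibre`** (`Dⁱ_{I×Λ}∫ = ∫Dⁱ`).
* §5 **`twoPtCt`**, `twoPtCt_eq`, `twoPtCt_zero_zero`, `expGrowth_expV_mul`, `integral_fibre_one_pos`, and the HEADLINE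
  **`contDiffOn_twoPtCt`: `(e,λ) ↦ G^{ct}_{ab}(e,λ;x,x′)` is `C^n` on `I ×ˢ Λ`**.
* §6 **`contDiffOn_twoPtCt_fst`** (`e ↦ G^{ct}(e,λ)` is `C^n` on `I` at every `λ ∈ Λ`), **`contDiffOn_twoPtCt_snd`** (`λ ↦ G^{ct}(e,λ)` within
  `Λ`), **`iteratedDeriv_iteratedDerivWithin_twoPtCt_eq`** (`∂^α_e∂^β_{λ,Λ}G^{ct}(e₀,t) = D^{α+β}_{I×Λ}G^{ct}(e₀,t)((1,0)^α,(0,1)^β)` — the mixed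
  partials exist for EVERY `(α,β)`), **`iteratedDeriv_iteratedDerivWithin_twoPtCt_comm`** (Schwarz: `∂^α_e∂^β_λ = ∂^β_λ∂^α_e` at
  `t ∈ Λ ∩ closure(interior Λ)`, e.g. `λ = 0⁺`), **`contDiffOn_iteratedDerivWithin_twoPtCt`** (`e ↦ ∂^β_{λ,Λ}G^{ct}(e,t)` is `C^α` on `I`),
  **`twoPtCt_taylor`** (the two-variable Taylor formula with Lagrange remainder at `(0,0⁺)` to every order `k`, coefficients
  `(α!(i−α)!)⁻¹∂^α_e∂^{i−α}_{λ,Λ}G^{ct}(0,0)`).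
* §7 (no counterterm) **`contDiffOn_twoPtCt_zero`** (`ℝ × [0,∞)`), **`contDiff_twoPt`** (BRICK 7's `twoPt` is `C^∞` on ALL of `ℝ`),
  **`twoPt_taylor`** (its `e`-Taylor formula with Lagrange remainder to every order).
v1.1 (same seat and gen, APPEND-ONLY after v1.0's last declaration `twoPt_taylor`; one new import `B1Eq362TaylorRemainder`):
* §8 **`twoPtCt_eq_pertSum362R_add_remainder`** / **`exists_abs_twoPtCt_sub_pertSum362R_le`** (+ the `ct = 0` instance
  `exists_abs_twoPtCt_zero_sub_pertSum362R_le`): for counterterms positive on a full slab `ℝ × [0,δ]`, the double Taylor polynomial of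
  `G^{ct}` to order `n̄` IS r12's one-sided perturbative sum `B1Sect3Statements.pertSum362R` — the shape
  `Σ_{0≤α+β≤n̄}(α!β!)⁻¹e^αλ^β∂^α_e∂^β_{λ,+}` of part I (I.3.36)/(I.3.62) — evaluated at `G^{ct}`, with Lagrange remainder and
  `O(‖(e,λ)‖^{n̄+1})` uniformly on boxes (the typer's generic `B1Eq362TaylorRemainder` BY NAME).
* §9 **`fibre_neg_charge`**, **`twoPtCt_neg_charge`** (charge conjugation `A ↦ −A`: `G^{ct}(−e,λ) = G^{ct}(e,λ)` for `e`-even `ct` —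
  BRICK 10 §13's reflection for this file's `twoPtCt`, so that the unbuilt BRICK 10 need not be imported),
  **`iteratedDeriv_odd_iteratedDerivWithin_twoPtCt_eq_zero`** / `iteratedDeriv_odd_twoPtCt_eq_zero`: EVERY coefficient
  `∂^α_e∂^β_{λ,Λ}G^{ct}(0,t)` with `α` odd vanishes (all `β`, all `t`) — why (1.23)'s index set `2 ≤ α+2β ≤ 4` lists only even `α`.
WHAT THIS GIVES THE ROWS.  B3.Eq1.19-1.22: the disclosure «no joint (e,λ)-Taylor statement, no all-orders statement» of BRICKS 7/10 is
lifted at the level of EXISTENCE — every coefficient of the double expansion of (1.19) in `(e,λ)` is a genuine joint (one-sided in `λ`)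
derivative, to all orders, for every jointly smooth counterterm positive on the slab.  B3.Eq1.23: print's index set `{(α,β) : 2 ≤ α+2β ≤ 4}`
— in particular WEIGHT 4, `(4,0)`, `(2,1)`, `(0,2)` — now consists of well-defined numbers `∂^α_e∂^β_λG^{ct}(0,0⁺)` (owner note (i): as
EXISTENCE of the partials only — the defining equations at weight 4 remain p26's typed `B3Eq123Counterterms.recursion_order_four` /
`solves_123`, no overlap claimed); BRICK 10's two readings of `(1,1)` («`e` first» §14, «`λ` first» §15) are one number by
`iteratedDeriv_iteratedDerivWithin_twoPtCt_comm`, for every smooth `ct` (not only affine in `λ`); at weight 3 the statement stays in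
referee D-g79-2's wording (owner note (ii)): what vanishes by BRICK 10 §13 is the order-`e³` ∕ `e¹λ¹` coefficient of the FULL two-point
function (1.19) for an `e`-even insertion — the 1PI letters `Σ^ε_{(3,0)}`, `Σ^ε_{(1,1)}` of (1.21) are not extracted, here or there.

HONEST SCOPE.  (i) Regularity and Taylor STRUCTURE only: no coefficient is evaluated here (orders `e²`: BRICK 7; `e²δm²`: BRICK 8; `λ`,
the weight-2 equations and weight 3: BRICK 10; weight 4: NOT evaluated anywhere yet), no Wick/graph statement, no 1PI/Dyson resummation
(1.21) (p32/p33/p37), no amputation.  (ii) Finite torus, Feynman gauge as the definition of the `A`-integral, `cη = 1` not even needed;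
nothing is uniform in `ε`, no `ε → 0` or «divergent/convergent» statement.  (iii) The positivity hypothesis `m² + ct(e,λ) > 0` on the
slab is where the Gaussian domination lives; at `λ > 0` the measure exists for any sign of the mass, but that regime is not treated.
(iv) `λ`-derivatives are WITHIN `Λ` (one-sided at `0`), as they must be (`e^{+λV}` is not integrable); `e`-derivatives are two-sided on
the open `I`.  (v) The parity statement (odd `α` vanish, §9) is in Mathlib's total derivatives, as in BRICK 10; existence is §6.  Mathlib +
the cited tree files only.  VERSIONS: v1.0 p374221 ✓ e1fb0f1519d9, v1.1 p376164 ✓ d83acf9080c1 (gen 26); v1.2 (gen 31) = §6's private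
slab lemmas (all but `taylor_slab`) replaced by the public `Literature.Analysis.Calculus.MixedPartialDerivWithin` §6 ones (−150 lines),
every public statement byte-identical; v1.3 (gen 32) = `taylor_slab` re-proved from the public `taylor_lagrange_mixed_partials_openFst`
(its tuple helper deleted, −45 lines), every public statement byte-identical.

References: [Balaban1983Higgs3] T. Bałaban, CMP 88 (1983) 411–445, (1.19)–(1.23) pp. 416–417; [Balaban1982Higgs1] T. Bałaban, CMP 85
(1982) 603–626, (1.7) p. 605 (`U(A) = exp(qεeA)`, *"We will assume only that ‖q‖ ≤ 1"*); [Folland1999] G. B. Folland, *Real Analysis*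
(2nd ed., Wiley 1999), Thm 2.27; [Coleman2012] R. Coleman, *Calculus on Normed Vector Spaces* (Springer 2012), §4.1 Thm 4.3, §4.5, §5.1
Thm 5.3; [GlimmJaffeQP1987] J. Glimm, A. Jaffe, *Quantum Physics* (2nd ed., Springer 1987), §8.2–8.5, §9.1 (perturbation series of
Euclidean lattice fields).
-/

noncomputable section

open scoped BigOperators InnerProductSpace Topology ContDiff

namespace Literature.MathematicalPhysics.QuantumFieldTheory.Balaban1983to89.B3Eq119JointSmooth

open _root_.MeasureTheory _root_.Filter Set Metric Function
open LatticeFieldCalculus B3WT223Instance B3WickVertexCalculus B3Eq122ChargeWick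

/-! ## §0 Toolbox (file-local): derivative bounds of the shape `‖D^i f(p)‖ ≤ K·θ^i` on the parameter plane `ℝ × ℝ` -/

section Toolbox

variable {F : Type*} [NormedAddCommGroup F] [NormedSpace ℝ F]

/-- `Σ_{j∈s}`-rule: termwise bounds `‖D^i f_j‖ ≤ K_jθ^i` on `T` (`i ≤ m`) give `‖D^i Σ_j f_j‖ ≤ (Σ_j K_j)θ^i`. [folklore] -/
private theorem db_sum {ι : Type*} (s : Finset ι) {m : ℕ} {T : Set (ℝ × ℝ)} {f : ι → ℝ × ℝ → F} {K : ι → ℝ} {θ : ℝ}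
    (hf : ∀ j ∈ s, ContDiff ℝ m (f j)) (hb : ∀ j ∈ s, ∀ i ≤ m, ∀ p ∈ T, ‖iteratedFDeriv ℝ i (f j) p‖ ≤ K j * θ ^ i)
    {i : ℕ} (hi : i ≤ m) {p : ℝ × ℝ} (hp : p ∈ T) :
    ‖iteratedFDeriv ℝ i (fun q => ∑ j ∈ s, f j q) p‖ ≤ (∑ j ∈ s, K j) * θ ^ i := by
  have him : (i : ℕ∞) ≤ m := by exact_mod_cast hi
  rw [iteratedFDeriv_sum fun j hj => ((hf j hj).of_le (by exact_mod_cast him)), Finset.sum_apply, Finset.sum_mul]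
  exact (norm_sum_le _ _).trans (Finset.sum_le_sum fun j hj => hb j hj i hi p hp)

/-- sum of two. [folklore] -/
private theorem db_add {m : ℕ} {T : Set (ℝ × ℝ)} {f g : ℝ × ℝ → F} {K K' θ : ℝ} (hf : ContDiff ℝ m f) (hg : ContDiff ℝ m g)
    (hbf : ∀ i ≤ m, ∀ p ∈ T, ‖iteratedFDeriv ℝ i f p‖ ≤ K * θ ^ i) (hbg : ∀ i ≤ m, ∀ p ∈ T, ‖iteratedFDeriv ℝ i g p‖ ≤ K' * θ ^ i)
    {i : ℕ} (hi : i ≤ m) {p : ℝ × ℝ} (hp : p ∈ T) :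
    ‖iteratedFDeriv ℝ i (fun q => f q + g q) p‖ ≤ (K + K') * θ ^ i := by
  have him : (i : ℕ∞) ≤ m := by exact_mod_cast hi
  have e : (fun q => f q + g q) = f + g := rfl
  rw [e, iteratedFDeriv_add_apply ((hf.of_le (by exact_mod_cast him)).contDiffAt)
    ((hg.of_le (by exact_mod_cast him)).contDiffAt), add_mul]
  exact (norm_add_le _ _).trans (add_le_add (hbf i hi p hp) (hbg i hi p hp))

/-- difference of two. [folklore] -/
private theorem db_sub {m : ℕ} {T : Set (ℝ × ℝ)} {f g : ℝ × ℝ → F} {K K' θ : ℝ} (hf : ContDiff ℝ m f) (hg : ContDiff ℝ m g)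
    (hbf : ∀ i ≤ m, ∀ p ∈ T, ‖iteratedFDeriv ℝ i f p‖ ≤ K * θ ^ i) (hbg : ∀ i ≤ m, ∀ p ∈ T, ‖iteratedFDeriv ℝ i g p‖ ≤ K' * θ ^ i)
    {i : ℕ} (hi : i ≤ m) {p : ℝ × ℝ} (hp : p ∈ T) :
    ‖iteratedFDeriv ℝ i (fun q => f q - g q) p‖ ≤ (K + K') * θ ^ i := by
  have him : (i : ℕ∞) ≤ m := by exact_mod_cast hi
  have e : (fun q => f q - g q) = f - g := rfl
  rw [e, iteratedFDeriv_sub_apply ((hf.of_le (by exact_mod_cast him)).contDiffAt)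
    ((hg.of_le (by exact_mod_cast him)).contDiffAt), add_mul]
  exact (norm_sub_le _ _).trans (add_le_add (hbf i hi p hp) (hbg i hi p hp))

/-- real multiples of a real function. [folklore] -/
private theorem db_const_mul {m : ℕ} {T : Set (ℝ × ℝ)} {f : ℝ × ℝ → ℝ} {K θ : ℝ} (a : ℝ) (hf : ContDiff ℝ m f)
    (hbf : ∀ i ≤ m, ∀ p ∈ T, ‖iteratedFDeriv ℝ i f p‖ ≤ K * θ ^ i) {i : ℕ} (hi : i ≤ m) {p : ℝ × ℝ} (hp : p ∈ T) :
    ‖iteratedFDeriv ℝ i (fun q => a * f q) p‖ ≤ (|a| * K) * θ ^ i := by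
  have him : (i : ℕ∞) ≤ m := by exact_mod_cast hi
  have e : (fun q => a * f q) = fun q => a • f q := rfl
  rw [e, iteratedFDeriv_const_smul_apply' ((hf.of_le (by exact_mod_cast him)).contDiffAt), norm_smul, Real.norm_eq_abs,
    mul_assoc]
  exact mul_le_mul_of_nonneg_left (hbf i hi p hp) (abs_nonneg a)

/-- constants (`θ ≥ 1`). [folklore] -/
private theorem db_const {T : Set (ℝ × ℝ)} (a : F) {θ : ℝ} (hθ : 1 ≤ θ) (i : ℕ) {p : ℝ × ℝ} (_hp : p ∈ T) :
    ‖iteratedFDeriv ℝ i (fun _ : ℝ × ℝ => a) p‖ ≤ ‖a‖ * θ ^ i := by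
  rcases Nat.eq_zero_or_pos i with h0 | hpos
  · subst h0
    rw [norm_iteratedFDeriv_zero, pow_zero, mul_one]
  · rw [iteratedFDeriv_const_of_ne (Nat.pos_iff_ne_zero.mp hpos) a]
    simp only [Pi.zero_apply, norm_zero]
    exact mul_nonneg (norm_nonneg _) (pow_nonneg (zero_le_one.trans hθ) _)

/-- monotonicity in the two constants. [folklore] -/
private theorem db_mono {m : ℕ} {T : Set (ℝ × ℝ)} {f : ℝ × ℝ → F} {K K' θ θ' : ℝ} (hK : K ≤ K') (hθ0 : 0 ≤ θ) (hθ : θ ≤ θ')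
    (hK' : 0 ≤ K') (hbf : ∀ i ≤ m, ∀ p ∈ T, ‖iteratedFDeriv ℝ i f p‖ ≤ K * θ ^ i) :
    ∀ i ≤ m, ∀ p ∈ T, ‖iteratedFDeriv ℝ i f p‖ ≤ K' * θ' ^ i := fun i hi p hp =>
  (hbf i hi p hp).trans (mul_le_mul hK (pow_le_pow_left₀ hθ0 hθ i) (pow_nonneg hθ0 _) hK')

/-- composition with the first coordinate projection (`‖pr₁‖ ≤ 1`). [folklore] -/
private theorem db_comp_fst {m : ℕ} {T : Set (ℝ × ℝ)} {g : ℝ → F} {K θ : ℝ} (hg : ContDiff ℝ m g) (hK : 0 ≤ K) (hθ : 0 ≤ θ)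
    (hb : ∀ i ≤ m, ∀ p ∈ T, ‖iteratedFDeriv ℝ i g p.1‖ ≤ K * θ ^ i) {i : ℕ} (hi : i ≤ m) {p : ℝ × ℝ} (hp : p ∈ T) :
    ‖iteratedFDeriv ℝ i (fun q : ℝ × ℝ => g q.1) p‖ ≤ K * θ ^ i := by
  have him : (i : WithTop ℕ∞) ≤ m := by exact_mod_cast hi
  have e : (fun q : ℝ × ℝ => g q.1) = g ∘ (ContinuousLinearMap.fst ℝ ℝ ℝ) := rfl
  rw [e, ContinuousLinearMap.iteratedFDeriv_comp_right _ hg p him]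
  refine (ContinuousMultilinearMap.norm_compContinuousLinearMap_le _ _).trans ?_
  have hprod : ∏ _i : Fin i, ‖ContinuousLinearMap.fst ℝ ℝ ℝ‖ ≤ 1 :=
    Finset.prod_le_one (fun _ _ => norm_nonneg _) fun _ _ => ContinuousLinearMap.norm_fst_le ℝ ℝ ℝ
  calc ‖iteratedFDeriv ℝ i g ((ContinuousLinearMap.fst ℝ ℝ ℝ) p)‖ * ∏ _i : Fin i, ‖ContinuousLinearMap.fst ℝ ℝ ℝ‖
      ≤ (K * θ ^ i) * 1 := mul_le_mul (hb i hi p hp) hprod (Finset.prod_nonneg fun _ _ => norm_nonneg _)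
          (mul_nonneg hK (pow_nonneg hθ _))
    _ = K * θ ^ i := mul_one _

/-- pairing with a fixed vector (`‖⟪u, ·⟫‖ = ‖u‖`): `‖D^i ⟪u, v(·)⟫‖ ≤ ‖u‖·‖D^i v‖`. [folklore] -/
private theorem db_inner_const {N : ℕ} {m : ℕ} {T : Set (ℝ × ℝ)} {v : ℝ × ℝ → EuclideanSpace ℝ (Fin N)} {K θ : ℝ}
    (u : EuclideanSpace ℝ (Fin N)) (hv : ContDiff ℝ m v) (hb : ∀ i ≤ m, ∀ p ∈ T, ‖iteratedFDeriv ℝ i v p‖ ≤ K * θ ^ i)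
    {i : ℕ} (hi : i ≤ m) {p : ℝ × ℝ} (hp : p ∈ T) :
    ‖iteratedFDeriv ℝ i (fun q => ⟪u, v q⟫_ℝ) p‖ ≤ (‖u‖ * K) * θ ^ i := by
  have him : (i : WithTop ℕ∞) ≤ m := by exact_mod_cast hi
  have e : (fun q => ⟪u, v q⟫_ℝ) = (innerSL ℝ u) ∘ v := by
    funext q; rfl
  rw [e]
  refine ((innerSL ℝ u).norm_iteratedFDeriv_comp_left (hv.contDiffAt) him).trans ?_
  rw [innerSL_apply_norm, mul_assoc]
  exact mul_le_mul_of_nonneg_left (hb i hi p hp) (norm_nonneg _)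

/-- the iterated derivatives of `t ↦ t·a`: `t·a`, `a`, `0`, `0`, …. [folklore] -/
private theorem iteratedDeriv_id_mul_const (a : ℝ) :
    ∀ i : ℕ, iteratedDeriv i (fun t : ℝ => t * a) = fun t => if i = 0 then t * a else if i = 1 then a else 0
  | 0 => by funext t; simp
  | 1 => by
      funext t
      rw [iteratedDeriv_one]
      simp
  | i + 2 => by
      funext t
      rw [iteratedDeriv_succ', show deriv (fun t : ℝ => t * a) = fun _ => a from by funext t; simp, iteratedDeriv_const]
      simp

/-- the linear term `p ↦ p.2·a` on a set where `|p.2| ≤ R` (`R, θ ≥ 1`): `‖D^i(p ↦ p.2·a)‖ ≤ R|a|·θ^i`. [folklore] -/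
private theorem db_snd_mul {m : ℕ} {T : Set (ℝ × ℝ)} (a : ℝ) {R θ : ℝ} (hR : 1 ≤ R) (hθ : 1 ≤ θ) (hT : ∀ p ∈ T, |p.2| ≤ R)
    {i : ℕ} (hi : i ≤ m) {p : ℝ × ℝ} (hp : p ∈ T) :
    ‖iteratedFDeriv ℝ i (fun q : ℝ × ℝ => q.2 * a) p‖ ≤ (R * |a|) * θ ^ i := by
  have hR0 : 0 ≤ R := zero_le_one.trans hR
  have hθ0 : 0 ≤ θ := zero_le_one.trans hθ
  have hg : ContDiff ℝ m (fun t : ℝ => t * a) := contDiff_id.mul contDiff_const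
  have him : (i : WithTop ℕ∞) ≤ m := by exact_mod_cast hi
  have e : (fun q : ℝ × ℝ => q.2 * a) = (fun t : ℝ => t * a) ∘ (ContinuousLinearMap.snd ℝ ℝ ℝ) := rfl
  rw [e, ContinuousLinearMap.iteratedFDeriv_comp_right _ hg p him]
  refine (ContinuousMultilinearMap.norm_compContinuousLinearMap_le _ _).trans ?_
  have hprod : ∏ _i : Fin i, ‖ContinuousLinearMap.snd ℝ ℝ ℝ‖ ≤ 1 :=
    Finset.prod_le_one (fun _ _ => norm_nonneg _) fun _ _ => ContinuousLinearMap.norm_snd_le ℝ ℝ ℝ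
  have h1 : R * |a| ≤ R * |a| * θ ^ i := le_mul_of_one_le_right (mul_nonneg hR0 (abs_nonneg a)) (one_le_pow₀ hθ)
  have hval : ‖iteratedFDeriv ℝ i (fun t : ℝ => t * a) ((ContinuousLinearMap.snd ℝ ℝ ℝ) p)‖ ≤ R * |a| * θ ^ i := by
    rw [norm_iteratedFDeriv_eq_norm_iteratedDeriv, iteratedDeriv_id_mul_const a i, ContinuousLinearMap.coe_snd']
    split_ifs with h0 h1'
    · rw [Real.norm_eq_abs, abs_mul]
      exact (mul_le_mul_of_nonneg_right (hT p hp) (abs_nonneg a)).trans h1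
    · rw [Real.norm_eq_abs]
      exact (le_mul_of_one_le_left (abs_nonneg a) hR).trans h1
    · rw [norm_zero]
      exact (mul_nonneg hR0 (abs_nonneg a)).trans h1
  calc ‖iteratedFDeriv ℝ i (fun t : ℝ => t * a) ((ContinuousLinearMap.snd ℝ ℝ ℝ) p)‖ * ∏ _i : Fin i, ‖ContinuousLinearMap.snd ℝ ℝ ℝ‖
      ≤ (R * |a| * θ ^ i) * 1 := mul_le_mul hval hprod (Finset.prod_nonneg fun _ _ => norm_nonneg _) (by positivity)
    _ = R * |a| * θ ^ i := mul_one _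

/-- a continuous function of the parameters is bounded on the closed unit ball around `p₀`; all derivatives of order `≤ m` of
a `C^m` function at once. [folklore] -/
private theorem exists_bound_iteratedFDeriv_closedBall {m : ℕ} {f : ℝ × ℝ → ℝ} (hf : ContDiff ℝ m f) (p₀ : ℝ × ℝ) :
    ∃ B : ℝ, 0 ≤ B ∧ ∀ i ≤ m, ∀ p ∈ closedBall p₀ 1, ‖iteratedFDeriv ℝ i f p‖ ≤ B := by
  have hK : IsCompact (closedBall p₀ (1 : ℝ)) := isCompact_closedBall p₀ 1
  have hi : ∀ i ≤ m, ∃ Bi : ℝ, 0 ≤ Bi ∧ ∀ p ∈ closedBall p₀ 1, ‖iteratedFDeriv ℝ i f p‖ ≤ Bi := by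
    intro i hi
    have hc : Continuous (iteratedFDeriv ℝ i f) := hf.continuous_iteratedFDeriv (by exact_mod_cast hi)
    obtain ⟨Bi, hBi⟩ := hK.exists_bound_of_continuousOn hc.continuousOn
    exact ⟨max Bi 0, le_max_right _ _, fun p hp => (hBi p hp).trans (le_max_left _ _)⟩
  choose! Bf hBf0 hBf using hi
  refine ⟨∑ i ∈ Finset.range (m + 1), Bf i, Finset.sum_nonneg fun i hi => hBf0 i (Nat.lt_succ_iff.mp (Finset.mem_range.mp hi)),
    fun i hi p hp => (hBf i hi p hp).trans ?_⟩
  exact Finset.single_le_sum (fun k hk => hBf0 k (Nat.lt_succ_iff.mp (Finset.mem_range.mp hk)))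
    (Finset.mem_range.mpr (Nat.lt_succ_of_le hi))

/-- the iterated derivatives of `u ↦ e^{−u}`. [folklore] -/
private theorem iteratedDeriv_exp_neg : ∀ i : ℕ, iteratedDeriv i (fun u : ℝ => Real.exp (-u)) = fun u => (-1) ^ i * Real.exp (-u)
  | 0 => by funext u; simp
  | i + 1 => by
      funext u
      rw [iteratedDeriv_succ, iteratedDeriv_exp_neg i]
      have h : HasDerivAt (fun u : ℝ => (-1 : ℝ) ^ i * Real.exp (-u)) ((-1) ^ i * (Real.exp (-u) * (-1))) u :=
        ((Real.hasDerivAt_exp (-u)).comp u (hasDerivAt_neg u)).const_mul _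
      rw [h.deriv, pow_succ]
      ring

/-- `‖D^i(u ↦ e^{−u})(u)‖ = e^{−u}`. [folklore] -/
private theorem norm_iteratedFDeriv_exp_neg (i : ℕ) (u : ℝ) :
    ‖iteratedFDeriv ℝ i (fun u : ℝ => Real.exp (-u)) u‖ = Real.exp (-u) := by
  rw [norm_iteratedFDeriv_eq_norm_iteratedDeriv, iteratedDeriv_exp_neg i]
  simp [abs_of_pos (Real.exp_pos _)]

end Toolbox

/-! ## §1 The charge path of the bond transport `e ↦ U(ηeA_b)v = exp(ηeA_b·q)v` and its derivatives -/

section UCe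

variable {N : ℕ} (C : HiggsLattice.ChargeData N) (η : ℝ)

/-- THE CHARGE PATH OF ONE BOND TRANSPORT: `e ↦ U(ηeA_b)v = exp(ηeA_b·q)v` (B1 (1.7): `U(A) = exp(qεeA)`), the only place where
the charge `e` enters the action (1.20) (BRICK 7's `quadForm_eq`/`hop`). [cite: Balaban1982Higgs1, (1.7) p.605] -/
def uCe (a : ℝ) (v : EuclideanSpace ℝ (Fin N)) (e : ℝ) : EuclideanSpace ℝ (Fin N) := (Ce C e).U η a v

/-- unfolding. [cite: Balaban1982Higgs1, (1.7) p.605] -/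
theorem uCe_apply (a : ℝ) (v : EuclideanSpace ℝ (Fin N)) (e : ℝ) : uCe C η a v e = (Ce C e).U η a v := rfl

/-- `d/de U(ηea)v = (ηa·q)U(ηea)v` (BRICK 7's `hasDerivAt_U`). [cite: Balaban1982Higgs1, (1.7) p.605] -/
theorem hasDerivAt_uCe (a : ℝ) (v : EuclideanSpace ℝ (Fin N)) (e : ℝ) :
    HasDerivAt (uCe C η a v) (((η * a) • C.q) (uCe C η a v e)) e := by
  have h : HasDerivAt (fun s : ℝ => (Ce C s).U η a v) ((η * a) • C.q ((Ce C e).U η a v)) e := hasDerivAt_U C η a v e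
  exact h.congr_deriv (by rw [smul_apply, uCe_apply])

/-- **`∂ⁱ_e U(ηea)v = (ηa·q)ⁱU(ηea)v`.** [cite: Balaban1982Higgs1, (1.7) p.605] -/
theorem iteratedDeriv_uCe (a : ℝ) (v : EuclideanSpace ℝ (Fin N)) :
    ∀ i : ℕ, iteratedDeriv i (uCe C η a v) = fun e => (((η * a) • C.q) ^ i) (uCe C η a v e)
  | 0 => by
      funext e
      rw [iteratedDeriv_zero, pow_zero, one_apply_eq_self]
  | i + 1 => by
      funext e
      rw [iteratedDeriv_succ, iteratedDeriv_uCe a v i]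
      have h : HasDerivAt (fun s => (((η * a) • C.q) ^ i) (uCe C η a v s))
          ((((η * a) • C.q) ^ i) (((η * a) • C.q) (uCe C η a v e))) e :=
        ((((η * a) • C.q) ^ i).hasFDerivAt).comp_hasDerivAt e (hasDerivAt_uCe C η a v e)
      rw [h.deriv, pow_succ, mul_apply_eq_comp]

/-- the charge path is `C^n` for every `n`. [cite: Balaban1982Higgs1, (1.7) p.605] -/
theorem contDiff_uCe (a : ℝ) (v : EuclideanSpace ℝ (Fin N)) {n : ℕ∞} : ContDiff ℝ n (uCe C η a v) := by
  have hd : Differentiable ℝ (uCe C η a v) := fun e => (hasDerivAt_uCe C η a v e).differentiableAt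
  have hderiv : deriv (uCe C η a v) = fun e => ((η * a) • C.q) (uCe C η a v e) :=
    funext fun e => (hasDerivAt_uCe C η a v e).deriv
  have hnat : ∀ m : ℕ, ContDiff ℝ m (uCe C η a v) := by
    intro m
    induction m with
    | zero => exact contDiff_zero.2 hd.continuous
    | succ m ih =>
      refine (contDiff_succ_iff_deriv (n := (m : WithTop ℕ∞))).2 ⟨hd, fun h => ?_, ?_⟩
      · exact absurd h (by exact_mod_cast WithTop.coe_ne_top)
      · rw [hderiv]
        exact ((η * a) • C.q).contDiff.comp ih
  have hinf : ContDiff ℝ (⊤ : ℕ∞) (uCe C η a v) := contDiff_infty.2 fun m => hnat m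
  exact hinf.of_le (by exact_mod_cast le_top)

omit C η in
/-- `‖Tⁱv‖ ≤ ‖T‖ⁱ‖v‖`. [folklore] -/
private theorem norm_pow_apply_le (T : EuclideanSpace ℝ (Fin N) →L[ℝ] EuclideanSpace ℝ (Fin N)) :
    ∀ (i : ℕ) (v : EuclideanSpace ℝ (Fin N)), ‖(T ^ i) v‖ ≤ ‖T‖ ^ i * ‖v‖
  | 0, v => by simp
  | i + 1, v => by
      rw [pow_succ, mul_apply_eq_comp, pow_succ]
      calc ‖(T ^ i) (T v)‖ ≤ ‖T‖ ^ i * ‖T v‖ := norm_pow_apply_le T i (T v)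
        _ ≤ ‖T‖ ^ i * (‖T‖ * ‖v‖) := mul_le_mul_of_nonneg_left (T.le_opNorm v) (pow_nonneg (norm_nonneg _) _)
        _ = ‖T‖ ^ i * ‖T‖ * ‖v‖ := by ring

/-- **`‖∂ⁱ_e U(ηea)v‖ ≤ (|η||a|)ⁱ‖v‖`** (`U` unitary, `‖q‖ ≤ 1`: B1 p. 605 *"We will assume only that ‖q‖ ≤ 1"*), uniformly in
`e`. [cite: Balaban1982Higgs1, (1.7) p.605] -/
theorem norm_iteratedDeriv_uCe_le (a : ℝ) (v : EuclideanSpace ℝ (Fin N)) (i : ℕ) (e : ℝ) :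
    ‖iteratedDeriv i (uCe C η a v) e‖ ≤ (|η| * |a|) ^ i * ‖v‖ := by
  rw [iteratedDeriv_uCe C η a v i]
  have hT : ‖(η * a) • C.q‖ ≤ |η| * |a| := by
    rw [norm_smul, Real.norm_eq_abs, abs_mul]
    exact mul_le_of_le_one_right (by positivity) C.norm_q_le
  calc ‖(((η * a) • C.q) ^ i) (uCe C η a v e)‖ ≤ ‖(η * a) • C.q‖ ^ i * ‖uCe C η a v e‖ := norm_pow_apply_le _ i _
    _ ≤ (|η| * |a|) ^ i * ‖v‖ := by
        rw [uCe_apply, ContinuousLinearMap.norm_map_of_mem_unitary ((Ce C e).U_mem_unitary η a)]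
        exact mul_le_mul_of_nonneg_right (pow_le_pow_left₀ (norm_nonneg _) hT i) (norm_nonneg _)

/-- the Fréchet form of the bound, uniform along the path: `|η||a| ≤ θ ⇒ ‖Dⁱ(e ↦ U(ηea)v)‖ ≤ ‖v‖θⁱ`.
[cite: Balaban1982Higgs1, (1.7) p.605] -/
theorem norm_iteratedFDeriv_uCe_le (a : ℝ) (v : EuclideanSpace ℝ (Fin N)) {θ : ℝ} (hθ : |η| * |a| ≤ θ) (i : ℕ) (e : ℝ) :
    ‖iteratedFDeriv ℝ i (uCe C η a v) e‖ ≤ ‖v‖ * θ ^ i := by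
  rw [norm_iteratedFDeriv_eq_norm_iteratedDeriv]
  refine (norm_iteratedDeriv_uCe_le C η a v i e).trans ?_
  rw [mul_comm]
  exact mul_le_mul_of_nonneg_left (pow_le_pow_left₀ (by positivity) hθ i) (norm_nonneg _)

/-- joint continuity of `(a, v) ↦ U(ηea)v`. [folklore] -/
private theorem continuous_U_apply₂ (e : ℝ) {X : Type*} [TopologicalSpace X] {f : X → ℝ} {g : X → EuclideanSpace ℝ (Fin N)}
    (hf : Continuous f) (hg : Continuous g) : Continuous fun x => (Ce C e).U η (f x) (g x) := by
  letI : NormedAlgebra ℚ (EuclideanSpace ℝ (Fin N) →L[ℝ] EuclideanSpace ℝ (Fin N)) := NormedAlgebra.restrictScalars ℚ ℝ _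
  have hU : Continuous fun x => (Ce C e).U η (f x) := by
    simp only [Ce_U]
    exact NormedSpace.exp_continuous.comp (((continuous_const.mul hf)).smul continuous_const)
  exact isBoundedBilinearMap_apply.continuous.comp (hU.prodMk hg)

end UCe

/-! ## §2 The integrand of (1.19)/(1.20) with the counterterm `δm² = ct(e,λ)` inserted and the quartic coupling `λ`, as a function
of the PAIR of expansion parameters `p = (e, λ)`; its total exponent; joint smoothness and the Faà di Bruno bound -/

section Fibre

variable {P : Params} {j N : ℕ} (C : HiggsLattice.ChargeData N) (η w c m2 μ2 : ℝ)

/-- the quartic interaction `V(φ) = Σ_y η^d∣φ(y)∣⁴` of (1.20). [cite: Balaban1983Higgs3, (1.20) p.416] -/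
def V4 (w : ℝ) (φ : Cfg P j N) : ℝ := ∑ y : Site P j, w * ‖φ y‖ ^ 4

/-- **THE INTEGRAND OF (1.19) WITH THE ACTION (1.20) AT CHARGE `e`, QUARTIC COUPLING `λ` AND COUNTERTERM `δm² = ct(e,λ)`**, on the
product space `z = (A, φ)`, as a function of `p = (e, λ)`: `e^{−S^ε_{e, m²+ct(e,λ)}(A,φ)}·e^{−λV(φ)}·F(φ)` — BRICK 7's joint weight `J`
at the running mass `m² + ct(e,λ)` (the counterterm is a mass shift, BRICK 10 `weight_mass_add`) times the Boltzmann factor of the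
quartic term times the observable (`F = φ_a(x)φ_b(x′)` for the numerator of (1.19), `F = 1` for `Z^ε`). This is VERBATIM the integrand of
BRICK 10's joint family (`B3Eq123RenormalizationConditions` §13–§15). [cite: Balaban1983Higgs3, (1.19)–(1.20) p.416] -/
def fibre (ct : ℝ → ℝ → ℝ) (F : Cfg P j N → ℝ) (p : ℝ × ℝ) (z : JCfg P j N) : ℝ :=
  J C η w c (m2 + ct p.1 p.2) μ2 p.1 z * (Real.exp (-(p.2 * V4 w z.2)) * F z.2)

/-- unfolding, in BRICK 10's spelling. [cite: Balaban1983Higgs3, (1.19)–(1.20) p.416] -/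
theorem fibre_apply (ct : ℝ → ℝ → ℝ) (F : Cfg P j N → ℝ) (p : ℝ × ℝ) (z : JCfg P j N) :
    fibre C η w c m2 μ2 ct F p z =
      J C η w c (m2 + ct p.1 p.2) μ2 p.1 z * (Real.exp (-(p.2 * ∑ y : Site P j, w * ‖z.2 y‖ ^ 4)) * F z.2) := rfl

/-- the `p`-independent part of the exponent: `½[Σ_b η^dc²(∣φ(b₊)∣² + ∣φ(b₋)∣²) + m²Σ_xη^d∣φ(x)∣²]`. [cite: Balaban1983Higgs3, (1.20) p.416] -/
def texp0 (z : JCfg P j N) : ℝ :=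
  (1 / 2 : ℝ) * ((∑ b : PBond P j, w * (c ^ 2 * (‖z.2 b.tgt‖ ^ 2 + ‖z.2 b.src‖ ^ 2))) + m2 * massForm w z.2)

/-- **THE TOTAL EXPONENT `W(e,λ; A,φ) = ½⟨φ,(−Δ^η_{A,e} + m² + ct(e,λ))φ⟩ + λV(φ)`** written so that the parameters appear explicitly:
`W = W₀(φ) + ½(Σ_xη^d∣φ(x)∣²)·ct(e,λ) − Σ_b η^dc²⟪φ(b₋), U(ηeA_b)φ(b₊)⟫ + λ·V(φ)` (the charge enters only through the hopping terms,
BRICK 7 `quadForm_eq`). [cite: Balaban1983Higgs3, (1.20) p.416] -/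
def texp (ct : ℝ → ℝ → ℝ) (p : ℝ × ℝ) (z : JCfg P j N) : ℝ :=
  texp0 w c m2 z + (1 / 2 : ℝ) * massForm w z.2 * ct p.1 p.2
    - (∑ b : PBond P j, w * (c ^ 2 * ⟪z.2 b.src, uCe C η (toVec z.1 b) (z.2 b.tgt) p.1⟫_ℝ))
    + p.2 * V4 w z.2

/-- `W = ½·quadForm + λV` (BRICK 7's quadratic form at charge `e` and mass `m² + ct(e,λ)`). [cite: Balaban1983Higgs3, (1.20) p.416] -/
theorem texp_eq_quadForm (ct : ℝ → ℝ → ℝ) (p : ℝ × ℝ) (z : JCfg P j N) :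
    texp C η w c m2 ct p z =
      (1 / 2 : ℝ) * quadForm (Ce C p.1) η w c (m2 + ct p.1 p.2) (toVec z.1) z.2 + p.2 * V4 w z.2 := by
  rw [quadForm_eq]
  unfold texp texp0 K0 hop uCe
  ring

/-- **the integrand is `(e^{−½⟨A,(−Δ^η+μ₀²)A⟩}·F(φ))·e^{−W(e,λ;A,φ)}`** — a `p`-INDEPENDENT factor times the exponential of minus the total
exponent. [cite: Balaban1983Higgs3, (1.19)–(1.20) p.416] -/
theorem fibre_eq_exp (ct : ℝ → ℝ → ℝ) (F : Cfg P j N → ℝ) (p : ℝ × ℝ) (z : JCfg P j N) :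
    fibre C η w c m2 μ2 ct F p z = (WA η w c μ2 z.1 * F z.2) * Real.exp (-texp C η w c m2 ct p z) := by
  rw [texp_eq_quadForm]
  unfold fibre J weight
  rw [show -((1 / 2 : ℝ) * quadForm (Ce C p.1) η w c (m2 + ct p.1 p.2) (toVec z.1) z.2 + p.2 * V4 w z.2)
      = -(1 / 2 : ℝ) * quadForm (Ce C p.1) η w c (m2 + ct p.1 p.2) (toVec z.1) z.2 + -(p.2 * V4 w z.2) by ring, Real.exp_add]
  ring

omit C η c m2 μ2 in
/-- `V ≥ 0` for `η^d ≥ 0`. [cite: Balaban1983Higgs3, (1.20) p.416] -/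
theorem V4_nonneg (hw : 0 ≤ w) (φ : Cfg P j N) : 0 ≤ V4 w φ := Finset.sum_nonneg fun _ _ => by positivity

omit C η c m2 μ2 in
/-- `V(φ) ≤ η^d·∣T∣·sup∣φ∣⁴`. [cite: Balaban1983Higgs3, (1.20) p.416] -/
theorem V4_le (hw : 0 ≤ w) (φ : Cfg P j N) : V4 w φ ≤ (w * Fintype.card (Site P j)) * ‖φ‖ ^ 4 := by
  unfold V4
  calc ∑ y : Site P j, w * ‖φ y‖ ^ 4 ≤ ∑ _y : Site P j, w * ‖φ‖ ^ 4 :=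
        Finset.sum_le_sum fun y _ => mul_le_mul_of_nonneg_left (pow_le_pow_left₀ (norm_nonneg _) (norm_le_pi_norm φ y) 4) hw
    _ = (w * Fintype.card (Site P j)) * ‖φ‖ ^ 4 := by rw [Finset.sum_const, Finset.card_univ, nsmul_eq_mul]; ring

omit C η c m2 μ2 in
/-- `Σ_xη^d∣φ(x)∣² ≤ η^d·∣T∣·sup∣φ∣²`. [cite: Balaban1983Higgs3, (1.20) p.416] -/
theorem massForm_le_card (hw : 0 ≤ w) (φ : Cfg P j N) : massForm w φ ≤ (w * Fintype.card (Site P j)) * ‖φ‖ ^ 2 := by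
  unfold massForm
  calc ∑ y : Site P j, w * ‖φ y‖ ^ 2 ≤ ∑ _y : Site P j, w * ‖φ‖ ^ 2 :=
        Finset.sum_le_sum fun y _ => mul_le_mul_of_nonneg_left (pow_le_pow_left₀ (norm_nonneg _) (norm_le_pi_norm φ y) 2) hw
    _ = (w * Fintype.card (Site P j)) * ‖φ‖ ^ 2 := by rw [Finset.sum_const, Finset.card_univ, nsmul_eq_mul]; ring

/-- the constant `Σ_b η^dc²` of the hopping-term bound. [cite: Balaban1983Higgs3, (1.20) p.416] -/
def Khop (P : Params) (j : ℕ) (w c : ℝ) : ℝ := ∑ _b : PBond P j, |w| * c ^ 2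

omit C η m2 μ2 in
/-- `K_hop ≥ 0`. [cite: Balaban1983Higgs3, (1.20) p.416] -/
theorem Khop_nonneg : 0 ≤ Khop P j w c := Finset.sum_nonneg fun _ _ => by positivity

omit C η μ2 in
/-- `∣W₀(φ)∣ ≤ (Σ_bη^dc² + ½∣m²∣η^d∣T∣)·sup∣φ∣²`. [cite: Balaban1983Higgs3, (1.20) p.416] -/
theorem abs_texp0_le (hw : 0 ≤ w) (z : JCfg P j N) :
    |texp0 w c m2 z| ≤ (Khop P j w c + (1 / 2 : ℝ) * (|m2| * (w * Fintype.card (Site P j)))) * ‖z.2‖ ^ 2 := by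
  unfold texp0 Khop
  have h1 : |∑ b : PBond P j, w * (c ^ 2 * (‖z.2 b.tgt‖ ^ 2 + ‖z.2 b.src‖ ^ 2))| ≤ ∑ _b : PBond P j, |w| * c ^ 2 * (2 * ‖z.2‖ ^ 2) := by
    refine (Finset.abs_sum_le_sum_abs _ _).trans (Finset.sum_le_sum fun b _ => ?_)
    rw [abs_mul, abs_mul, abs_of_nonneg (sq_nonneg c), abs_of_nonneg (by positivity : (0:ℝ) ≤ ‖z.2 b.tgt‖ ^ 2 + ‖z.2 b.src‖ ^ 2),
      mul_assoc]
    refine mul_le_mul_of_nonneg_left (mul_le_mul_of_nonneg_left ?_ (sq_nonneg c)) (abs_nonneg w)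
    have ht := pow_le_pow_left₀ (norm_nonneg _) (norm_le_pi_norm z.2 b.tgt) 2
    have hs := pow_le_pow_left₀ (norm_nonneg _) (norm_le_pi_norm z.2 b.src) 2
    linarith
  have h2 : |m2 * massForm w z.2| ≤ |m2| * ((w * Fintype.card (Site P j)) * ‖z.2‖ ^ 2) := by
    rw [abs_mul, abs_of_nonneg (massForm_nonneg hw z.2)]
    exact mul_le_mul_of_nonneg_left (massForm_le_card w hw z.2) (abs_nonneg _)
  rw [abs_mul, abs_of_pos (by norm_num : (0:ℝ) < 1 / 2)]
  calc (1 / 2 : ℝ) * |(∑ b : PBond P j, w * (c ^ 2 * (‖z.2 b.tgt‖ ^ 2 + ‖z.2 b.src‖ ^ 2))) + m2 * massForm w z.2|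
      ≤ (1 / 2 : ℝ) * ((∑ _b : PBond P j, |w| * c ^ 2 * (2 * ‖z.2‖ ^ 2)) + |m2| * ((w * Fintype.card (Site P j)) * ‖z.2‖ ^ 2)) :=
        mul_le_mul_of_nonneg_left ((abs_add_le _ _).trans (add_le_add h1 h2)) (by norm_num)
    _ = (∑ _b : PBond P j, |w| * c ^ 2 + (1 / 2 : ℝ) * (|m2| * (w * Fintype.card (Site P j)))) * ‖z.2‖ ^ 2 := by
        rw [Finset.sum_const, Finset.sum_const, Finset.card_univ, nsmul_eq_mul, nsmul_eq_mul]; ring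

/-! ### joint smoothness of the exponent and of the integrand in `p = (e, λ)` -/

/-- the exponent is jointly `C^n` in `(e,λ)` for a jointly `C^n` counterterm. [cite: Balaban1983Higgs3, (1.20) p.416, p.417] -/
theorem contDiff_texp {ct : ℝ → ℝ → ℝ} {n : ℕ∞} (hct : ContDiff ℝ n (fun p : ℝ × ℝ => ct p.1 p.2)) (z : JCfg P j N) :
    ContDiff ℝ n (fun p : ℝ × ℝ => texp C η w c m2 ct p z) := by
  unfold texp
  refine (((contDiff_const.add (contDiff_const.mul hct)).sub ?_).add (contDiff_snd.mul contDiff_const))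
  refine ContDiff.sum fun b _ => contDiff_const.mul (contDiff_const.mul ?_)
  exact (contDiff_const.inner ℝ ((contDiff_uCe C η (toVec z.1 b) (z.2 b.tgt)).comp contDiff_fst))

/-- **the integrand is jointly `C^n` in `(e,λ)`** (on all of `ℝ²`, for every field configuration).
[cite: Balaban1983Higgs3, (1.19)–(1.20) p.416, p.417] -/
theorem contDiff_fibre {ct : ℝ → ℝ → ℝ} {n : ℕ∞} (hct : ContDiff ℝ n (fun p : ℝ × ℝ => ct p.1 p.2)) (F : Cfg P j N → ℝ)
    (z : JCfg P j N) : ContDiff ℝ n (fun p : ℝ × ℝ => fibre C η w c m2 μ2 ct F p z) := by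
  have e : (fun p : ℝ × ℝ => fibre C η w c m2 μ2 ct F p z)
      = fun p => (WA η w c μ2 z.1 * F z.2) * Real.exp (-texp C η w c m2 ct p z) := funext fun p => fibre_eq_exp C η w c m2 μ2 ct F p z
  rw [e]
  exact contDiff_const.mul (contDiff_texp C η w c m2 hct z).neg.exp

/-- the integrand is continuous in the fields `z = (A, φ)` for a continuous observable. [cite: Balaban1983Higgs3, (1.19) p.416] -/
theorem continuous_fibre_field {F : Cfg P j N → ℝ} (hF : Continuous F) (ct : ℝ → ℝ → ℝ) (p : ℝ × ℝ) :
    Continuous fun z : JCfg P j N => fibre C η w c m2 μ2 ct F p z := by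
  have e : (fun z : JCfg P j N => fibre C η w c m2 μ2 ct F p z)
      = fun z => (WA η w c μ2 z.1 * F z.2) * Real.exp (-texp C η w c m2 ct p z) := funext fun z => fibre_eq_exp C η w c m2 μ2 ct F p z
  rw [e]
  have hWA : Continuous fun z : JCfg P j N => WA η w c μ2 z.1 :=
    (B3WT224Instance.continuous_weight (Cvec P.d) η w c μ2 _).comp continuous_fst
  have hsq : ∀ x : Site P j, Continuous fun z : JCfg P j N => ‖z.2 x‖ := fun x => ((continuous_apply x).comp continuous_snd).norm
  have hmass : Continuous fun z : JCfg P j N => massForm w z.2 := by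
    unfold massForm; exact continuous_finsetSum _ fun x _ => continuous_const.mul ((hsq x).pow 2)
  have htexp : Continuous fun z : JCfg P j N => texp C η w c m2 ct p z := by
    unfold texp texp0 V4
    refine (((continuous_const.mul ((continuous_finsetSum _ fun b _ => continuous_const.mul (continuous_const.mul
      (((hsq b.tgt).pow 2).add ((hsq b.src).pow 2)))).add (continuous_const.mul hmass))).add
      ((continuous_const.mul hmass).mul continuous_const)).sub ?_).add
      (continuous_const.mul (continuous_finsetSum _ fun y _ => continuous_const.mul ((hsq y).pow 4)))
    refine continuous_finsetSum _ fun b _ => continuous_const.mul (continuous_const.mul ?_)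
    simp only [uCe_apply]
    exact ((continuous_apply b.src).comp continuous_snd).inner
      (continuous_U_apply₂ C η p.1 (((continuous_apply b.src).comp continuous_fst).inner continuous_const)
        ((continuous_apply b.tgt).comp continuous_snd))
  exact (hWA.mul (hF.comp continuous_snd)).mul htexp.neg.rexp

/-! ### the derivative bounds -/

omit C η c m2 μ2 in
/-- `∣A_b∣ ≤ sup∣A∣` for the vector field in components. [folklore] -/
private theorem abs_toVec_le' (A : Cfg P j P.d) (b : PBond P j) : |toVec A b| ≤ ‖A‖ := by
  rw [toVec_apply]
  calc |⟪A b.src, EuclideanSpace.basisFun (Fin P.d) ℝ b.dir⟫_ℝ|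
      ≤ ‖A b.src‖ * ‖EuclideanSpace.basisFun (Fin P.d) ℝ b.dir‖ := abs_real_inner_le_norm _ _
    _ = ‖A b.src‖ := by rw [(EuclideanSpace.basisFun (Fin P.d) ℝ).orthonormal.1, mul_one]
    _ ≤ ‖A‖ := norm_le_pi_norm A b.src

/-- **THE EXPONENT HAS DERIVATIVES OF CONTROLLED GROWTH**: on the closed unit ball around `p₀ = (e₀,λ₀)`, for every order `i ≤ m`,
`‖Dⁱ_{(e,λ)}W(e,λ;A,φ)‖ ≤ [∣W₀(φ)∣ + ½(Σ_xη^d∣φ∣²)B_ct + (Σ_bη^dc²)sup∣φ∣² + (∣λ₀∣+1)V(φ)]·(1 + ∣η∣sup∣A∣)ⁱ`, where `B_ct` bounds the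
derivatives of order `≤ m` of the counterterm on that ball (each hopping term `⟪φ(b₋),U(ηeA_b)φ(b₊)⟫` contributes `∣φ(b₋)∣∣φ(b₊)∣(∣η∣∣A_b∣)ⁱ`,
`U` unitary, `‖q‖ ≤ 1`). [cite: Balaban1983Higgs3, (1.20) p.416; Balaban1982Higgs1, (1.7) p.605] -/
theorem norm_iteratedFDeriv_texp_le (hw : 0 ≤ w) {ct : ℝ → ℝ → ℝ} {m : ℕ} (hct : ContDiff ℝ m (fun p : ℝ × ℝ => ct p.1 p.2))
    (p₀ : ℝ × ℝ) {Bct : ℝ} (hBct0 : 0 ≤ Bct)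
    (hBct : ∀ i ≤ m, ∀ p ∈ closedBall p₀ 1, ‖iteratedFDeriv ℝ i (fun p : ℝ × ℝ => ct p.1 p.2) p‖ ≤ Bct)
    (z : JCfg P j N) {i : ℕ} (hi : i ≤ m) {p : ℝ × ℝ} (hp : p ∈ closedBall p₀ 1) :
    ‖iteratedFDeriv ℝ i (fun q : ℝ × ℝ => texp C η w c m2 ct q z) p‖ ≤
      (|texp0 w c m2 z| + (1 / 2 : ℝ) * massForm w z.2 * Bct + Khop P j w c * ‖z.2‖ ^ 2 + (|p₀.2| + 1) * V4 w z.2)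
        * (1 + |η| * ‖z.1‖) ^ i := by
  set θ : ℝ := 1 + |η| * ‖z.1‖ with hθ
  have hθ1 : 1 ≤ θ := by rw [hθ]; exact le_add_of_nonneg_right (by positivity)
  have hθ0 : 0 ≤ θ := zero_le_one.trans hθ1
  set T : Set (ℝ × ℝ) := closedBall p₀ 1 with hT
  -- (a) the constant `W₀`
  have ha : ∀ i ≤ m, ∀ p ∈ T, ‖iteratedFDeriv ℝ i (fun _ : ℝ × ℝ => texp0 w c m2 z) p‖ ≤ |texp0 w c m2 z| * θ ^ i :=
    fun i _ p hp => (db_const (texp0 w c m2 z) hθ1 i hp).trans (by rw [Real.norm_eq_abs])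
  -- (b) the counterterm term `½(Σ∣φ∣²)·ct(p)`
  have hb0 : ∀ i ≤ m, ∀ p ∈ T, ‖iteratedFDeriv ℝ i (fun q : ℝ × ℝ => ct q.1 q.2) p‖ ≤ Bct * θ ^ i :=
    fun i hi p hp => (hBct i hi p hp).trans (le_mul_of_one_le_right hBct0 (one_le_pow₀ hθ1))
  have hb : ∀ i ≤ m, ∀ p ∈ T, ‖iteratedFDeriv ℝ i (fun q : ℝ × ℝ => ((1 / 2 : ℝ) * massForm w z.2) * ct q.1 q.2) p‖
      ≤ (|(1 / 2 : ℝ) * massForm w z.2| * Bct) * θ ^ i := fun i hi p hp => db_const_mul _ hct hb0 hi hp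
  -- (c) the hopping terms
  have hc1 : ∀ b : PBond P j, ∀ i ≤ m, ∀ p ∈ T,
      ‖iteratedFDeriv ℝ i (fun q : ℝ × ℝ => ⟪z.2 b.src, uCe C η (toVec z.1 b) (z.2 b.tgt) q.1⟫_ℝ) p‖
        ≤ (‖z.2 b.src‖ * ‖z.2 b.tgt‖) * θ ^ i := by
    intro b i hi p hp
    have hθb : |η| * |toVec z.1 b| ≤ θ :=
      (mul_le_mul_of_nonneg_left (abs_toVec_le' z.1 b) (abs_nonneg η)).trans (le_add_of_nonneg_left zero_le_one)
    have hpath : ∀ i ≤ m, ∀ p ∈ T, ‖iteratedFDeriv ℝ i (uCe C η (toVec z.1 b) (z.2 b.tgt)) p.1‖ ≤ ‖z.2 b.tgt‖ * θ ^ i :=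
      fun i _ p _ => norm_iteratedFDeriv_uCe_le C η (toVec z.1 b) (z.2 b.tgt) hθb i p.1
    have hcomp : ∀ i ≤ m, ∀ p ∈ T, ‖iteratedFDeriv ℝ i (fun q : ℝ × ℝ => uCe C η (toVec z.1 b) (z.2 b.tgt) q.1) p‖
        ≤ ‖z.2 b.tgt‖ * θ ^ i :=
      fun i hi p hp => db_comp_fst ((contDiff_uCe C η _ _).of_le (by exact_mod_cast le_rfl)) (norm_nonneg _) hθ0 hpath hi hp
    exact db_inner_const (z.2 b.src) (((contDiff_uCe C η (toVec z.1 b) (z.2 b.tgt)).comp contDiff_fst)) hcomp hi hp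
  have hc : ∀ i ≤ m, ∀ p ∈ T,
      ‖iteratedFDeriv ℝ i (fun q : ℝ × ℝ => ∑ b : PBond P j, w * (c ^ 2 * ⟪z.2 b.src, uCe C η (toVec z.1 b) (z.2 b.tgt) q.1⟫_ℝ)) p‖
        ≤ (∑ b : PBond P j, |w| * (|c ^ 2| * (‖z.2 b.src‖ * ‖z.2 b.tgt‖))) * θ ^ i := by
    intro i hi p hp
    refine db_sum Finset.univ (fun b _ => contDiff_const.mul (contDiff_const.mul
      ((contDiff_const.inner ℝ ((contDiff_uCe C η (toVec z.1 b) (z.2 b.tgt)).comp contDiff_fst))))) (fun b _ => ?_) hi hp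
    intro i hi p hp
    have h1 := hc1 b
    have h2 : ∀ i ≤ m, ∀ p ∈ T, ‖iteratedFDeriv ℝ i (fun q : ℝ × ℝ => c ^ 2 * ⟪z.2 b.src, uCe C η (toVec z.1 b) (z.2 b.tgt) q.1⟫_ℝ) p‖
        ≤ (|c ^ 2| * (‖z.2 b.src‖ * ‖z.2 b.tgt‖)) * θ ^ i :=
      fun i hi p hp => db_const_mul _ ((contDiff_const.inner ℝ ((contDiff_uCe C η (toVec z.1 b) (z.2 b.tgt)).comp contDiff_fst))) h1 hi hp
    exact db_const_mul _ (contDiff_const.mul ((contDiff_const.inner ℝ ((contDiff_uCe C η (toVec z.1 b) (z.2 b.tgt)).comp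
      contDiff_fst)))) h2 hi hp
  -- (d) the quartic term `λ·V`
  have hR : ∀ p ∈ T, |p.2| ≤ |p₀.2| + 1 := by
    intro p hp
    have h := (mem_closedBall.1 hp)
    have h2 : |p.2 - p₀.2| ≤ 1 := by
      calc |p.2 - p₀.2| = ‖(p - p₀).2‖ := by rw [Prod.snd_sub, Real.norm_eq_abs]
        _ ≤ ‖p - p₀‖ := norm_snd_le _
        _ ≤ 1 := by rwa [← dist_eq_norm]
    calc |p.2| = |(p.2 - p₀.2) + p₀.2| := by rw [sub_add_cancel]
      _ ≤ |p.2 - p₀.2| + |p₀.2| := abs_add_le _ _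
      _ ≤ |p₀.2| + 1 := by linarith
  have hd : ∀ i ≤ m, ∀ p ∈ T, ‖iteratedFDeriv ℝ i (fun q : ℝ × ℝ => q.2 * V4 w z.2) p‖ ≤ ((|p₀.2| + 1) * |V4 w z.2|) * θ ^ i :=
    fun i hi p hp => db_snd_mul (V4 w z.2) (le_add_of_nonneg_left (abs_nonneg _)) hθ1 hR hi hp
  -- assembling
  have hfa : ContDiff ℝ m (fun _ : ℝ × ℝ => texp0 w c m2 z) := contDiff_const
  have hfb : ContDiff ℝ m (fun q : ℝ × ℝ => ((1 / 2 : ℝ) * massForm w z.2) * ct q.1 q.2) := contDiff_const.mul hct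
  have hfc : ContDiff ℝ m (fun q : ℝ × ℝ => ∑ b : PBond P j, w * (c ^ 2 * ⟪z.2 b.src, uCe C η (toVec z.1 b) (z.2 b.tgt) q.1⟫_ℝ)) :=
    ContDiff.sum fun b _ => contDiff_const.mul (contDiff_const.mul
      ((contDiff_const.inner ℝ ((contDiff_uCe C η (toVec z.1 b) (z.2 b.tgt)).comp contDiff_fst))))
  have hfd : ContDiff ℝ m (fun q : ℝ × ℝ => q.2 * V4 w z.2) := contDiff_snd.mul contDiff_const
  have hab := fun i (hi : i ≤ m) p (hp : p ∈ T) => db_add hfa hfb ha hb hi hp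
  have habc := fun i (hi : i ≤ m) p (hp : p ∈ T) => db_sub (hfa.add hfb) hfc hab hc hi hp
  have habcd := db_add ((hfa.add hfb).sub hfc) hfd habc hd hi hp
  have e : (fun q : ℝ × ℝ => texp C η w c m2 ct q z) = fun q => (texp0 w c m2 z + ((1 / 2 : ℝ) * massForm w z.2) * ct q.1 q.2
      - ∑ b : PBond P j, w * (c ^ 2 * ⟪z.2 b.src, uCe C η (toVec z.1 b) (z.2 b.tgt) q.1⟫_ℝ)) + q.2 * V4 w z.2 := by
    funext q; unfold texp; ring
  rw [e]
  refine habcd.trans (mul_le_mul_of_nonneg_right ?_ (pow_nonneg hθ0 _))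
  have hm0 : 0 ≤ massForm w z.2 := massForm_nonneg hw z.2
  have hV0 : 0 ≤ V4 w z.2 := V4_nonneg w hw z.2
  rw [abs_of_nonneg (by positivity : (0:ℝ) ≤ (1 / 2 : ℝ) * massForm w z.2), abs_of_nonneg hV0]
  have hK : ∑ b : PBond P j, |w| * (|c ^ 2| * (‖z.2 b.src‖ * ‖z.2 b.tgt‖)) ≤ Khop P j w c * ‖z.2‖ ^ 2 := by
    unfold Khop
    rw [Finset.sum_mul]
    refine Finset.sum_le_sum fun b _ => ?_
    rw [abs_of_nonneg (sq_nonneg c), mul_assoc]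
    refine mul_le_mul_of_nonneg_left (mul_le_mul_of_nonneg_left ?_ (sq_nonneg c)) (abs_nonneg w)
    rw [sq]
    exact mul_le_mul (norm_le_pi_norm _ _) (norm_le_pi_norm _ _) (norm_nonneg _) (norm_nonneg _)
  linarith

/-- the growth constant of the coarse bound `‖DⁱW‖ ≤ B·(1+sup∣φ∣²)²·(1+∣η∣sup∣A∣)ⁱ` (depends on the counterterm bound `B_ct` and on
`R = ∣λ₀∣ + 1`). [cite: Balaban1983Higgs3, (1.20) p.416] -/
def growK (P : Params) (j : ℕ) (w c m2 Bct R : ℝ) : ℝ :=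
  2 * Khop P j w c + (|m2| + Bct + R) * (w * Fintype.card (Site P j))

omit C η μ2 in
/-- `growK ≥ 0`. [cite: Balaban1983Higgs3, (1.20) p.416] -/
theorem growK_nonneg (hw : 0 ≤ w) {Bct R : ℝ} (hB : 0 ≤ Bct) (hR : 0 ≤ R) : 0 ≤ growK P j w c m2 Bct R := by
  unfold growK
  have := Khop_nonneg (P := P) (j := j) w c
  positivity

/-- **coarse form: `‖Dⁱ_{(e,λ)}W‖ ≤ B·(1 + sup∣φ∣²)²·(1 + ∣η∣sup∣A∣)ⁱ`** on the closed unit ball around `(e₀,λ₀)`, `i ≤ m`.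
[cite: Balaban1983Higgs3, (1.20) p.416; Balaban1982Higgs1, (1.7) p.605] -/
theorem norm_iteratedFDeriv_texp_le' (hw : 0 ≤ w) {ct : ℝ → ℝ → ℝ} {m : ℕ} (hct : ContDiff ℝ m (fun p : ℝ × ℝ => ct p.1 p.2))
    (p₀ : ℝ × ℝ) {Bct : ℝ} (hBct0 : 0 ≤ Bct)
    (hBct : ∀ i ≤ m, ∀ p ∈ closedBall p₀ 1, ‖iteratedFDeriv ℝ i (fun p : ℝ × ℝ => ct p.1 p.2) p‖ ≤ Bct)
    (z : JCfg P j N) {i : ℕ} (hi : i ≤ m) {p : ℝ × ℝ} (hp : p ∈ closedBall p₀ 1) :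
    ‖iteratedFDeriv ℝ i (fun q : ℝ × ℝ => texp C η w c m2 ct q z) p‖ ≤
      growK P j w c m2 Bct (|p₀.2| + 1) * (1 + ‖z.2‖ ^ 2) ^ 2 * (1 + |η| * ‖z.1‖) ^ i := by
  refine (norm_iteratedFDeriv_texp_le C η w c m2 hw hct p₀ hBct0 hBct z hi hp).trans
    (mul_le_mul_of_nonneg_right ?_ (pow_nonneg (by positivity) _))
  have h0 := abs_texp0_le w c m2 hw z
  have h1 := massForm_le_card w hw z.2
  have h2 := V4_le w hw z.2
  have hK := Khop_nonneg (P := P) (j := j) w c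
  have hcard : 0 ≤ w * Fintype.card (Site P j) := by positivity
  have hR0 : 0 ≤ |p₀.2| + 1 := by positivity
  set X : ℝ := ‖z.2‖ ^ 2 with hX
  set S : ℝ := (1 + ‖z.2‖ ^ 2) ^ 2 with hS
  have hX0 : 0 ≤ X := sq_nonneg _
  have hs2 : X ≤ S := by rw [hX, hS]; nlinarith [sq_nonneg ‖z.2‖]
  have hs4 : ‖z.2‖ ^ 4 ≤ S := by rw [hS]; nlinarith [sq_nonneg ‖z.2‖]
  have e4 : ‖z.2‖ ^ 4 = X * X := by rw [hX]; ring
  have t1 : |texp0 w c m2 z| ≤ (Khop P j w c + (1 / 2 : ℝ) * (|m2| * (w * Fintype.card (Site P j)))) * S :=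
    h0.trans (mul_le_mul_of_nonneg_left hs2 (by positivity))
  have t2 : (1 / 2 : ℝ) * massForm w z.2 * Bct ≤ (1 / 2 : ℝ) * Bct * (w * Fintype.card (Site P j)) * S := by
    have := mul_le_mul_of_nonneg_left (h1.trans (mul_le_mul_of_nonneg_left hs2 hcard)) (by positivity : (0:ℝ) ≤ 1 / 2 * Bct)
    linarith
  have t3 : Khop P j w c * ‖z.2‖ ^ 2 ≤ Khop P j w c * S := mul_le_mul_of_nonneg_left hs2 hK
  have t4 : (|p₀.2| + 1) * V4 w z.2 ≤ (|p₀.2| + 1) * (w * Fintype.card (Site P j)) * S := by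
    have := mul_le_mul_of_nonneg_left (h2.trans (mul_le_mul_of_nonneg_left hs4 hcard)) hR0
    linarith
  have hS0 : 0 ≤ S := by positivity
  unfold growK
  nlinarith [t1, t2, t3, t4, mul_nonneg hK hS0, mul_nonneg (mul_nonneg (abs_nonneg m2) hcard) hS0,
    mul_nonneg (mul_nonneg hBct0 hcard) hS0, mul_nonneg (mul_nonneg hR0 hcard) hS0]

/-- **FAÀ DI BRUNO FOR THE INTEGRAND: `‖Dⁱ_{(e,λ)}[e^{−S^ε}e^{−λV}F]‖ ≤ i!·max(1, B(1+sup∣φ∣²)²(1+∣η∣sup∣A∣)^m)ⁱ·∣e^{−S^ε}e^{−λV}F∣`**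
for `(e,λ)` in the closed unit ball around `(e₀,λ₀)` and `i ≤ m` — every parameter derivative of the integrand is the integrand
itself times a weight of polynomial growth in the fields (Mathlib's `norm_iteratedFDeriv_comp_le` for `u ↦ e^{−u}` composed with
the exponent `W`). [cite: Balaban1983Higgs3, (1.19)–(1.20) p.416, p.417] -/
theorem norm_iteratedFDeriv_fibre_le (hw : 0 ≤ w) {ct : ℝ → ℝ → ℝ} {m : ℕ} (hct : ContDiff ℝ m (fun p : ℝ × ℝ => ct p.1 p.2))
    (p₀ : ℝ × ℝ) {Bct : ℝ} (hBct0 : 0 ≤ Bct)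
    (hBct : ∀ i ≤ m, ∀ p ∈ closedBall p₀ 1, ‖iteratedFDeriv ℝ i (fun p : ℝ × ℝ => ct p.1 p.2) p‖ ≤ Bct)
    (F : Cfg P j N → ℝ) (z : JCfg P j N) {i : ℕ} (hi : i ≤ m) {p : ℝ × ℝ} (hp : p ∈ closedBall p₀ 1) :
    ‖iteratedFDeriv ℝ i (fun q : ℝ × ℝ => fibre C η w c m2 μ2 ct F q z) p‖ ≤
      (i.factorial : ℝ) * (max 1 (growK P j w c m2 Bct (|p₀.2| + 1) * (1 + ‖z.2‖ ^ 2) ^ 2 * (1 + |η| * ‖z.1‖) ^ m)) ^ i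
        * |fibre C η w c m2 μ2 ct F p z| := by
  set D : ℝ := max 1 (growK P j w c m2 Bct (|p₀.2| + 1) * (1 + ‖z.2‖ ^ 2) ^ 2 * (1 + |η| * ‖z.1‖) ^ m) with hD
  have hD1 : 1 ≤ D := le_max_left _ _
  have hθ1 : 1 ≤ 1 + |η| * ‖z.1‖ := le_add_of_nonneg_right (by positivity)
  have hg : ContDiff ℝ (m : ℕ∞) (fun u : ℝ => Real.exp (-u)) := contDiff_neg.exp
  have hf : ContDiff ℝ (m : ℕ∞) (fun q : ℝ × ℝ => texp C η w c m2 ct q z) :=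
    contDiff_texp C η w c m2 (by exact_mod_cast hct) z
  have hC : ∀ k, k ≤ i → ‖iteratedFDeriv ℝ k (fun u : ℝ => Real.exp (-u)) (texp C η w c m2 ct p z)‖
      ≤ Real.exp (-texp C η w c m2 ct p z) := fun k _ => (norm_iteratedFDeriv_exp_neg k _).le
  have hDk : ∀ k, 1 ≤ k → k ≤ i → ‖iteratedFDeriv ℝ k (fun q : ℝ × ℝ => texp C η w c m2 ct q z) p‖ ≤ D ^ k := by
    intro k hk1 hki
    refine (norm_iteratedFDeriv_texp_le' C η w c m2 hw hct p₀ hBct0 hBct z (hki.trans hi) hp).trans ?_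
    calc growK P j w c m2 Bct (|p₀.2| + 1) * (1 + ‖z.2‖ ^ 2) ^ 2 * (1 + |η| * ‖z.1‖) ^ k
        ≤ growK P j w c m2 Bct (|p₀.2| + 1) * (1 + ‖z.2‖ ^ 2) ^ 2 * (1 + |η| * ‖z.1‖) ^ m :=
          mul_le_mul_of_nonneg_left (pow_le_pow_right₀ hθ1 (hki.trans hi))
            (mul_nonneg (growK_nonneg w c m2 hw hBct0 (by positivity)) (by positivity))
      _ ≤ D := le_max_right _ _
      _ ≤ D ^ k := le_self_pow₀ hD1 (by omega)
  have hcomp := norm_iteratedFDeriv_comp_le (g := fun u : ℝ => Real.exp (-u)) hg hf (by exact_mod_cast hi) p hC hDk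
  have e : (fun q : ℝ × ℝ => fibre C η w c m2 μ2 ct F q z)
      = fun q => (WA η w c μ2 z.1 * F z.2) • ((fun u : ℝ => Real.exp (-u)) ∘ fun q : ℝ × ℝ => texp C η w c m2 ct q z) q := by
    funext q
    rw [fibre_eq_exp, smul_eq_mul]
    rfl
  have him : (i : ℕ∞) ≤ m := by exact_mod_cast hi
  have hgf : ContDiff ℝ (m : ℕ∞) ((fun u : ℝ => Real.exp (-u)) ∘ fun q : ℝ × ℝ => texp C η w c m2 ct q z) := hg.comp hf
  rw [e, iteratedFDeriv_const_smul_apply' ((hgf.of_le (by exact_mod_cast him)).contDiffAt), norm_smul, Real.norm_eq_abs]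
  have habs : |fibre C η w c m2 μ2 ct F p z| = |WA η w c μ2 z.1 * F z.2| * Real.exp (-texp C η w c m2 ct p z) := by
    rw [fibre_eq_exp, abs_mul, abs_of_pos (Real.exp_pos _)]
  rw [habs]
  calc |WA η w c μ2 z.1 * F z.2| * ‖iteratedFDeriv ℝ i ((fun u : ℝ => Real.exp (-u)) ∘ fun q : ℝ × ℝ => texp C η w c m2 ct q z) p‖
      ≤ |WA η w c μ2 z.1 * F z.2| * ((i.factorial : ℝ) * Real.exp (-texp C η w c m2 ct p z) * D ^ i) :=
        mul_le_mul_of_nonneg_left hcomp (abs_nonneg _)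
    _ = (i.factorial : ℝ) * D ^ i * (|WA η w c μ2 z.1 * F z.2| * Real.exp (-texp C η w c m2 ct p z)) := by ring

end Fibre

/-! ## §3 Domination on the parameter set `I ×ˢ Λ` (`Λ ⊆ [0,∞)`, `m² + ct > 0`): one integrable majorant of all parameter derivatives
of order `≤ m`, locally uniformly -/

section Majorant

variable {P : Params} {j N : ℕ} (C : HiggsLattice.ChargeData N) (η w c m2 μ2 : ℝ)

omit C m2 in
/-- the product majorant `[W_A(A)e^{κ_A sup∣A∣}]·[e^{κ sup∣φ∣}e^{−(m₀η^d/2)Σ∣φ∣²}]` is integrable on `(A,φ)`-space for `m₀ > 0` (BRICK 7's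
`integrable_majorant` with a variable `A`-exponent and mass). [cite: Balaban1983Higgs3, (1.19) p.416] -/
theorem integrable_majorant' (hw : 0 < w) (hμ : 0 < μ2) {m₀ : ℝ} (hm₀ : 0 < m₀) (κA κ : ℝ) (hκA : 0 ≤ κA) :
    Integrable (fun z : JCfg P j N => (WA η w c μ2 z.1 * Real.exp (κA * ‖z.1‖)) *
      (Real.exp (κ * ‖z.2‖) * Real.exp (-(m₀ * w / 2) * ∑ x : Site P j, ‖z.2 x‖ ^ 2))) := by
  have hA : Integrable (fun A : Cfg P j P.d => WA η w c μ2 A * Real.exp (κA * ‖A‖)) :=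
    ExpGrowth.integrable (Cvec P.d) η w c μ2 hw hμ
      ⟨(continuous_const.mul continuous_norm).rexp, 1, κA, zero_le_one, hκA,
        fun A => by rw [abs_of_pos (Real.exp_pos _), one_mul]⟩
  have hφ := B3WT224Instance.integrable_explin_mul_gauss (P := P) (j := j) (N := N) κ (half_pos (mul_pos hm₀ hw))
  have h := hA.mul_prod hφ
  rw [← Measure.volume_eq_prod] at h
  exact h

omit C η c m2 μ2 in
/-- `1 + t² ≤ 2e^t` for `t ≥ 0`. [folklore] -/
private theorem one_add_sq_le_two_exp {t : ℝ} (ht : 0 ≤ t) : 1 + t ^ 2 ≤ 2 * Real.exp t := by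
  have h1 : 1 + t + t ^ 2 / 2 ≤ Real.exp t := by
    have := Real.quadratic_le_exp_of_nonneg ht
    linarith
  nlinarith

omit C η c m2 μ2 in
/-- `1 + t ≤ e^t`. [folklore] -/
private theorem one_add_le_exp' (t : ℝ) : 1 + t ≤ Real.exp t := by linarith [Real.add_one_le_exp t]

/-- **THE INTEGRABLE MAJORANT.**  Let `Λ ⊆ [0,∞)`, `(e₀,λ₀) ∈ I ×ˢ Λ` with `m² + ct(e₀,λ₀) > 0`, `ct` jointly `C^m` and `F` of
exponential-linear growth.  Then there are `ε > 0` and an integrable `g` on `(A,φ)`-space with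
`‖Dⁱ_{(e,λ)}[e^{−S^ε}e^{−λV}F](A,φ)‖ ≤ g(A,φ)` for all `i ≤ m`, all `(A,φ)` and all `(e,λ) ∈ (I ×ˢ Λ) ∩ B((e₀,λ₀),ε)` (the Faà di Bruno
weight is absorbed by the Gaussians: `e^{−S^ε} ≤ W_A(A)e^{−(m₀η^d/2)Σ∣φ∣²}` at the local mass minimum `m₀`, `e^{−λV} ≤ 1`).
[cite: Balaban1983Higgs3, (1.19)–(1.20) p.416, p.417] -/
theorem exists_fibre_majorant (hw : 0 < w) (hμ : 0 < μ2) {I Λ : Set ℝ} (hΛ : Λ ⊆ Ici 0) {ct : ℝ → ℝ → ℝ} {m : ℕ}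
    (hct : ContDiff ℝ m (fun p : ℝ × ℝ => ct p.1 p.2)) {F : Cfg P j N → ℝ} (hF : ExpGrowth F) {p₀ : ℝ × ℝ}
    (hpos : 0 < m2 + ct p₀.1 p₀.2) :
    ∃ ε > 0, ∃ g : JCfg P j N → ℝ, Integrable g ∧ ∀ z : JCfg P j N, ∀ i ≤ m, ∀ p ∈ (I ×ˢ Λ) ∩ ball p₀ ε,
      ‖iteratedFDeriv ℝ i (fun q : ℝ × ℝ => fibre C η w c m2 μ2 ct F q z) p‖ ≤ g z := by
  obtain ⟨hFc, KF, κ, hKF, hκ, hFb⟩ := hF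
  obtain ⟨Bct, hBct0, hBct⟩ := exists_bound_iteratedFDeriv_closedBall hct p₀
  -- local lower bound of the running mass
  set M₀ : ℝ := m2 + ct p₀.1 p₀.2 with hM₀
  have hctc : Continuous (fun p : ℝ × ℝ => ct p.1 p.2) := hct.continuous
  obtain ⟨ε₁, hε₁, hε₁b⟩ := Metric.continuousAt_iff.1 (hctc.continuousAt (x := p₀)) (M₀ / 2) (half_pos hpos)
  set ε : ℝ := min ε₁ 1 with hε
  have hεpos : 0 < ε := lt_min hε₁ one_pos
  set m₀ : ℝ := M₀ / 2 with hm₀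
  have hm₀pos : 0 < m₀ := half_pos hpos
  have hmass : ∀ p ∈ ball p₀ ε, m₀ ≤ m2 + ct p.1 p.2 := by
    intro p hp
    have hd : dist p p₀ < ε₁ := lt_of_lt_of_le (mem_ball.1 hp) (min_le_left _ _)
    have h := hε₁b hd
    rw [Real.dist_eq] at h
    have := (abs_sub_lt_iff.1 h).2
    rw [hm₀, hM₀] at *
    linarith
  -- the constants
  set Bg : ℝ := growK P j w c m2 Bct (|p₀.2| + 1) with hBg
  have hBg0 : 0 ≤ Bg := growK_nonneg w c m2 hw.le hBct0 (by positivity)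
  set Cst : ℝ := (m.factorial : ℝ) * ((1 + Bg) ^ m * (4 : ℝ) ^ m) * KF with hCst
  refine ⟨ε, hεpos, fun z => Cst * ((WA η w c μ2 z.1 * Real.exp ((m * m * |η|) * ‖z.1‖)) *
      (Real.exp ((2 * m + κ) * ‖z.2‖) * Real.exp (-(m₀ * w / 2) * ∑ x : Site P j, ‖z.2 x‖ ^ 2))),
    (integrable_majorant' η w c μ2 hw hμ hm₀pos _ _ (by positivity)).const_mul Cst, fun z i hi p hp => ?_⟩
  have hpS := hp.1
  have hpB : p ∈ closedBall p₀ 1 := mem_closedBall.2 ((mem_ball.1 hp.2).le.trans (min_le_right _ _))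
  have hlam : 0 ≤ p.2 := hΛ (mem_prod.1 hpS).2
  refine (norm_iteratedFDeriv_fibre_le C η w c m2 μ2 hw.le hct p₀ hBct0 hBct F z hi hpB).trans ?_
  -- the integrand against the Gaussians
  have hWA : 0 < WA η w c μ2 z.1 := WA_pos η w c μ2 z.1
  have hV : 0 ≤ V4 w z.2 := V4_nonneg w hw.le z.2
  have hexpV : Real.exp (-(p.2 * V4 w z.2)) ≤ 1 := Real.exp_le_one_iff.2 (by nlinarith)
  have hwt : weight (Ce C p.1) η w c (m2 + ct p.1 p.2) (toVec z.1) z.2 ≤ Real.exp (-(m₀ * w / 2) * ∑ x : Site P j, ‖z.2 x‖ ^ 2) := by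
    refine (weight_le_gauss (C := Ce C p.1) (η := η) (c := c) (M2 := m2 + ct p.1 p.2) hw.le (toVec z.1) z.2).trans ?_
    rw [Real.exp_le_exp]
    have hs : 0 ≤ ∑ x : Site P j, ‖z.2 x‖ ^ 2 := Finset.sum_nonneg fun _ _ => sq_nonneg _
    have := hmass p hp.2
    nlinarith [mul_nonneg hw.le hs]
  have hfib : |fibre C η w c m2 μ2 ct F p z| ≤ WA η w c μ2 z.1 * Real.exp (-(m₀ * w / 2) * ∑ x : Site P j, ‖z.2 x‖ ^ 2) *
      (KF * Real.exp (κ * ‖z.2‖)) := by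
    rw [fibre, B3Eq122ChargeWick.J, abs_mul, abs_mul, abs_mul, abs_of_pos hWA, abs_of_pos (weight_pos _ _), abs_of_pos (Real.exp_pos _)]
    calc WA η w c μ2 z.1 * weight (Ce C p.1) η w c (m2 + ct p.1 p.2) (toVec z.1) z.2 * (Real.exp (-(p.2 * V4 w z.2)) * |F z.2|)
        ≤ WA η w c μ2 z.1 * Real.exp (-(m₀ * w / 2) * ∑ x : Site P j, ‖z.2 x‖ ^ 2) * (1 * (KF * Real.exp (κ * ‖z.2‖))) :=
          mul_le_mul (mul_le_mul_of_nonneg_left hwt hWA.le) (mul_le_mul hexpV (hFb z.2) (abs_nonneg _) zero_le_one)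
            (mul_nonneg (Real.exp_pos _).le (abs_nonneg _)) (mul_nonneg hWA.le (Real.exp_pos _).le)
      _ = _ := by rw [one_mul]
  -- the Faà di Bruno weight against exponential-linear growth
  set D : ℝ := max 1 (Bg * (1 + ‖z.2‖ ^ 2) ^ 2 * (1 + |η| * ‖z.1‖) ^ m) with hD
  have hD1 : 1 ≤ D := le_max_left _ _
  have hθ1 : 1 ≤ 1 + |η| * ‖z.1‖ := le_add_of_nonneg_right (by positivity)
  have hDle : D ≤ (1 + Bg) * ((1 + ‖z.2‖ ^ 2) ^ 2 * (1 + |η| * ‖z.1‖) ^ m) := by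
    have hX1 : 1 ≤ (1 + ‖z.2‖ ^ 2) ^ 2 * (1 + |η| * ‖z.1‖) ^ m :=
      one_le_mul_of_one_le_of_one_le (one_le_pow₀ (by nlinarith)) (one_le_pow₀ hθ1)
    refine max_le (by nlinarith) ?_
    nlinarith [mul_nonneg hBg0 (zero_le_one.trans hX1)]
  have hDi : D ^ i ≤ ((1 + Bg) * ((1 + ‖z.2‖ ^ 2) ^ 2 * (1 + |η| * ‖z.1‖) ^ m)) ^ m :=
    (pow_le_pow_right₀ hD1 hi).trans (pow_le_pow_left₀ (zero_le_one.trans hD1) hDle m)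
  have hφ : ((1 + ‖z.2‖ ^ 2) ^ 2) ^ m ≤ (4 : ℝ) ^ m * Real.exp ((2 * m) * ‖z.2‖) := by
    have h1 := one_add_sq_le_two_exp (norm_nonneg z.2)
    have h2 : (1 + ‖z.2‖ ^ 2) ^ 2 ≤ 4 * Real.exp (2 * ‖z.2‖) := by
      calc (1 + ‖z.2‖ ^ 2) ^ 2 ≤ (2 * Real.exp ‖z.2‖) ^ 2 := pow_le_pow_left₀ (by positivity) h1 2
        _ = 4 * Real.exp (2 * ‖z.2‖) := by
            rw [mul_pow, ← Real.exp_nat_mul]; norm_num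
    calc ((1 + ‖z.2‖ ^ 2) ^ 2) ^ m ≤ (4 * Real.exp (2 * ‖z.2‖)) ^ m := pow_le_pow_left₀ (by positivity) h2 m
      _ = (4 : ℝ) ^ m * Real.exp ((2 * m) * ‖z.2‖) := by
          rw [mul_pow, ← Real.exp_nat_mul, show ((m : ℕ) : ℝ) * (2 * ‖z.2‖) = (2 * m) * ‖z.2‖ by ring]
  have hA : ((1 + |η| * ‖z.1‖) ^ m) ^ m ≤ Real.exp ((m * m * |η|) * ‖z.1‖) := by
    calc ((1 + |η| * ‖z.1‖) ^ m) ^ m ≤ (Real.exp (|η| * ‖z.1‖) ^ m) ^ m :=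
          pow_le_pow_left₀ (by positivity) (pow_le_pow_left₀ (by positivity) (one_add_le_exp' _) m) m
      _ = Real.exp ((m * m * |η|) * ‖z.1‖) := by
          rw [← Real.exp_nat_mul, ← Real.exp_nat_mul, show ((m : ℕ) : ℝ) * ((m : ℕ) * (|η| * ‖z.1‖)) = (m * m * |η|) * ‖z.1‖ by ring]
  have hfact : (i.factorial : ℝ) ≤ m.factorial := by exact_mod_cast Nat.factorial_le hi
  have hDi' : D ^ i ≤ (1 + Bg) ^ m * (((4 : ℝ) ^ m * Real.exp ((2 * m) * ‖z.2‖)) * Real.exp ((m * m * |η|) * ‖z.1‖)) := by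
    refine hDi.trans ?_
    rw [mul_pow, mul_pow]
    exact mul_le_mul_of_nonneg_left (mul_le_mul hφ hA (by positivity) (by positivity)) (by positivity)
  -- assembling
  have hrhs0 : 0 ≤ WA η w c μ2 z.1 * Real.exp (-(m₀ * w / 2) * ∑ x : Site P j, ‖z.2 x‖ ^ 2) * (KF * Real.exp (κ * ‖z.2‖)) := by
    positivity
  calc (i.factorial : ℝ) * D ^ i * |fibre C η w c m2 μ2 ct F p z|
      ≤ (m.factorial : ℝ) * ((1 + Bg) ^ m * (((4 : ℝ) ^ m * Real.exp ((2 * m) * ‖z.2‖)) * Real.exp ((m * m * |η|) * ‖z.1‖)))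
          * (WA η w c μ2 z.1 * Real.exp (-(m₀ * w / 2) * ∑ x : Site P j, ‖z.2 x‖ ^ 2) * (KF * Real.exp (κ * ‖z.2‖))) :=
        mul_le_mul (mul_le_mul hfact hDi' (pow_nonneg (zero_le_one.trans hD1) _) (by positivity)) hfib (abs_nonneg _)
          (by positivity)
    _ = Cst * ((WA η w c μ2 z.1 * Real.exp ((m * m * |η|) * ‖z.1‖)) *
          (Real.exp ((2 * m + κ) * ‖z.2‖) * Real.exp (-(m₀ * w / 2) * ∑ x : Site P j, ‖z.2 x‖ ^ 2))) := by
        rw [hCst, show (2 * (m : ℝ) + κ) * ‖z.2‖ = (2 * m) * ‖z.2‖ + κ * ‖z.2‖ by ring, Real.exp_add]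
        ring

end Majorant

/-! ## §4 `C^n` UNDER `∫dA dφ` WITHIN THE SLAB `I ×ˢ Λ`: the numerator and the partition function of (1.19) are jointly `C^n` in
`(e, λ)`, every derivative the integral of the derivative of the integrand (Folland's Thm 2.27 iterated, within a convex set —
`Literature.Analysis.FunctionSpaces.SmoothParametricIntegralWithin`) -/

section Engine

variable {P : Params} {j N : ℕ} (C : HiggsLattice.ChargeData N) (η w c m2 μ2 : ℝ)

/-- all parameter derivatives of the integrand are (strongly) measurable in the fields. [cite: Balaban1983Higgs3, (1.19) p.416] -/
theorem aestronglyMeasurable_iteratedFDeriv_fibre {ct : ℝ → ℝ → ℝ} {n : ℕ∞} (hct : ContDiff ℝ n (fun p : ℝ × ℝ => ct p.1 p.2))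
    {F : Cfg P j N → ℝ} (hF : Continuous F) :
    ∀ i : ℕ, (i : ℕ∞) ≤ n → ∀ p : ℝ × ℝ,
      AEStronglyMeasurable (fun z : JCfg P j N => iteratedFDeriv ℝ i (fun q : ℝ × ℝ => fibre C η w c m2 μ2 ct F q z) p) volume :=
  Literature.Analysis.FunctionSpaces.aestronglyMeasurable_iteratedFDeriv_param (n := n)
    (fun z => contDiff_fibre C η w c m2 μ2 hct F z) (fun p => (continuous_fibre_field C η w c m2 μ2 hF ct p).aestronglyMeasurable)

/-- **THE TAYLOR SERIES OF `(e,λ) ↦ ∫dA dφ e^{−S^ε_{e,m²+ct(e,λ)}}e^{−λV}F` WITHIN THE SLAB `I ×ˢ Λ`** (`I`, `Λ` convex, `Λ ⊆ [0,∞)`,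
`m² + ct > 0` on the slab, `ct` jointly `C^n`, `F` of exponential-linear growth): up to order `n`, with the coefficients
`∫dA dφ Dⁱ_{(e,λ)}[e^{−S^ε}e^{−λV}F]` — differentiation under the integral sign to every order, one-sided at `λ = 0`.
[cite: Balaban1983Higgs3, (1.19)–(1.20) p.416, p.417] -/
theorem hasFTaylorSeriesUpToOn_integral_fibre (hw : 0 < w) (hμ : 0 < μ2) {I Λ : Set ℝ} (hI : Convex ℝ I) (hΛc : Convex ℝ Λ)
    (hΛ : Λ ⊆ Ici 0) {ct : ℝ → ℝ → ℝ} {n : ℕ∞} (hct : ContDiff ℝ n (fun p : ℝ × ℝ => ct p.1 p.2))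
    (hpos : ∀ p ∈ I ×ˢ Λ, 0 < m2 + ct p.1 p.2) {F : Cfg P j N → ℝ} (hF : ExpGrowth F) :
    HasFTaylorSeriesUpToOn n (fun p : ℝ × ℝ => ∫ z : JCfg P j N, fibre C η w c m2 μ2 ct F p z)
      (fun p i => ∫ z : JCfg P j N, iteratedFDeriv ℝ i (fun q : ℝ × ℝ => fibre C η w c m2 μ2 ct F q z) p) (I ×ˢ Λ) := by
  refine Literature.Analysis.FunctionSpaces.hasFTaylorSeriesUpToOn_integral_of_dominated (hI.prod hΛc)
    (fun z => contDiff_fibre C η w c m2 μ2 hct F z)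
    (fun i hi p _ => aestronglyMeasurable_iteratedFDeriv_fibre C η w c m2 μ2 hct hF.1 i hi p) ?_
  intro i hi p₀ hp₀
  obtain ⟨ε, hε, g, hg, hgb⟩ := exists_fibre_majorant C η w c m2 μ2 hw hμ (I := I) hΛ
    ((hct.of_le (by exact_mod_cast hi)) : ContDiff ℝ i (fun p : ℝ × ℝ => ct p.1 p.2)) hF (hpos p₀ hp₀)
  exact ⟨ε, hε, g, hg, Eventually.of_forall fun z p hp => hgb z i le_rfl p hp⟩

/-- **`(e,λ) ↦ ∫dA dφ e^{−S^ε}e^{−λV}F` is jointly `C^n` on the slab.** [cite: Balaban1983Higgs3, (1.19)–(1.20) p.416, p.417] -/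
theorem contDiffOn_integral_fibre (hw : 0 < w) (hμ : 0 < μ2) {I Λ : Set ℝ} (hI : Convex ℝ I) (hΛc : Convex ℝ Λ)
    (hΛ : Λ ⊆ Ici 0) {ct : ℝ → ℝ → ℝ} {n : ℕ∞} (hct : ContDiff ℝ n (fun p : ℝ × ℝ => ct p.1 p.2))
    (hpos : ∀ p ∈ I ×ˢ Λ, 0 < m2 + ct p.1 p.2) {F : Cfg P j N → ℝ} (hF : ExpGrowth F) :
    ContDiffOn ℝ n (fun p : ℝ × ℝ => ∫ z : JCfg P j N, fibre C η w c m2 μ2 ct F p z) (I ×ˢ Λ) :=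
  (hasFTaylorSeriesUpToOn_integral_fibre C η w c m2 μ2 hw hμ hI hΛc hΛ hct hpos hF).contDiffOn

/-- **the derivatives under the integral sign**: `Dⁱ_{I×Λ}∫e^{−S^ε}e^{−λV}F = ∫Dⁱ_{(e,λ)}[e^{−S^ε}e^{−λV}F]` (`i ≤ n`, slab of unique
differentiability). [cite: Balaban1983Higgs3, (1.19)–(1.20) p.416, p.417] -/
theorem iteratedFDerivWithin_integral_fibre (hw : 0 < w) (hμ : 0 < μ2) {I Λ : Set ℝ} (hI : Convex ℝ I) (hΛc : Convex ℝ Λ)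
    (hIu : UniqueDiffOn ℝ I) (hΛu : UniqueDiffOn ℝ Λ) (hΛ : Λ ⊆ Ici 0) {ct : ℝ → ℝ → ℝ} {n : ℕ∞}
    (hct : ContDiff ℝ n (fun p : ℝ × ℝ => ct p.1 p.2)) (hpos : ∀ p ∈ I ×ˢ Λ, 0 < m2 + ct p.1 p.2) {F : Cfg P j N → ℝ}
    (hF : ExpGrowth F) {i : ℕ} (hi : (i : ℕ∞) ≤ n) {p : ℝ × ℝ} (hp : p ∈ I ×ˢ Λ) :
    iteratedFDerivWithin ℝ i (fun q : ℝ × ℝ => ∫ z : JCfg P j N, fibre C η w c m2 μ2 ct F q z) (I ×ˢ Λ) p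
      = ∫ z : JCfg P j N, iteratedFDeriv ℝ i (fun q : ℝ × ℝ => fibre C η w c m2 μ2 ct F q z) p :=
  ((hasFTaylorSeriesUpToOn_integral_fibre C η w c m2 μ2 hw hμ hI hΛc hΛ hct hpos hF).eq_iteratedFDerivWithin_of_uniqueDiffOn
    (by exact_mod_cast hi) (hIu.prod hΛu) hp).symm

end Engine

/-! ## §5 THE TWO-POINT FUNCTION (1.19) WITH COUNTERTERM AND QUARTIC COUPLING AS A FUNCTION OF `(e, λ)`: jointly `C^n` on the slab -/

section TwoPt

variable {P : Params} {j N : ℕ} (C : HiggsLattice.ChargeData N) (η w c m2 μ2 : ℝ)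

/-- **(1.19) AS A FUNCTION OF THE PAIR OF EXPANSION PARAMETERS `(e, λ)`** — the two-point Schwinger function of the action (1.20) at
charge `e`, quartic coupling `λ` and mass counterterm `δm² = ct(e,λ)`:
`G^{ct}_{ab}(e,λ; x,x′) = ∫dA dφ e^{−S^ε}e^{−λV}φ_a(x)φ_b(x′) / ∫dA dφ e^{−S^ε}e^{−λV}`. [cite: Balaban1983Higgs3, (1.19)–(1.20) p.416] -/
def twoPtCt (ct : ℝ → ℝ → ℝ) (p : ℝ × ℝ) (a b : Fin N) (x x' : Site P j) : ℝ :=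
  (∫ z : JCfg P j N, fibre C η w c m2 μ2 ct (legs a b x x') p z) / ∫ z : JCfg P j N, fibre C η w c m2 μ2 ct (fun _ => 1) p z

/-- **`G^{ct}` IS BRICK 10's JOINT FAMILY VERBATIM** (`B3Eq123RenormalizationConditions` §13–§15: `twoPtJoint_neg_charge`,
`hasDerivAt_twoPtJoint_massCurve_of_ball`, `hasDerivWithinAt_twoPtJoint_affine`, …). [cite: Balaban1983Higgs3, (1.19)–(1.20) p.416] -/
theorem twoPtCt_eq (ct : ℝ → ℝ → ℝ) (p : ℝ × ℝ) (a b : Fin N) (x x' : Site P j) :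
    twoPtCt C η w c m2 μ2 ct p a b x x' =
      (∫ z : JCfg P j N, J C η w c (m2 + ct p.1 p.2) μ2 p.1 z *
          (Real.exp (-(p.2 * ∑ y : Site P j, w * ‖z.2 y‖ ^ 4)) * legs a b x x' z.2)) /
        ∫ z : JCfg P j N, J C η w c (m2 + ct p.1 p.2) μ2 p.1 z * Real.exp (-(p.2 * ∑ y : Site P j, w * ‖z.2 y‖ ^ 4)) := by
  simp only [twoPtCt, fibre_apply, mul_one]

/-- **BRICK 7's `twoPt` (no counterterm, `λ = 0`) is the slice `G^{0}(e, 0)`.** [cite: Balaban1983Higgs3, (1.19) p.416] -/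
theorem twoPtCt_zero_zero (e : ℝ) (a b : Fin N) (x x' : Site P j) :
    twoPtCt C η w c m2 μ2 (fun _ _ => 0) (e, 0) a b x x' = twoPt C η w c m2 μ2 e a b x x' := by
  rw [twoPtCt_eq, twoPt_eq]
  simp only [add_zero, zero_mul, neg_zero, Real.exp_zero, one_mul, mul_one]

omit C η c m2 μ2 in
/-- the Boltzmann factor times an observable of exponential-linear growth is again one, for `λ ≥ 0` (`e^{−λV} ≤ 1`).
[cite: Balaban1983Higgs3, (1.20) p.416] -/
theorem expGrowth_expV_mul (hw : 0 ≤ w) {lam : ℝ} (hlam : 0 ≤ lam) {F : Cfg P j N → ℝ} (hF : ExpGrowth F) :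
    ExpGrowth (fun φ : Cfg P j N => Real.exp (-(lam * V4 w φ)) * F φ) := by
  obtain ⟨hFc, K, κ, hK, hκ, hFb⟩ := hF
  have hVc : Continuous (fun φ : Cfg P j N => V4 w φ) := by
    unfold V4; exact continuous_finsetSum _ fun y _ => continuous_const.mul ((continuous_apply y).norm.pow 4)
  refine ⟨(continuous_const.mul hVc).neg.rexp.mul hFc, K, κ, hK, hκ, fun φ => ?_⟩
  rw [abs_mul, abs_of_pos (Real.exp_pos _)]
  have h1 : Real.exp (-(lam * V4 w φ)) ≤ 1 := Real.exp_le_one_iff.2 (by nlinarith [V4_nonneg w hw φ])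
  calc Real.exp (-(lam * V4 w φ)) * |F φ| ≤ 1 * (K * Real.exp (κ * ‖φ‖)) :=
        mul_le_mul h1 (hFb φ) (abs_nonneg _) zero_le_one
    _ = K * Real.exp (κ * ‖φ‖) := one_mul _

/-- **the partition function with counterterm and quartic coupling is positive** on the slab (`λ ≥ 0`, `m² + ct(e,λ) > 0`).
[cite: Balaban1983Higgs3, (1.19) p.416] -/
theorem integral_fibre_one_pos (hw : 0 < w) (hμ : 0 < μ2) {ct : ℝ → ℝ → ℝ} {p : ℝ × ℝ} (hlam : 0 ≤ p.2)
    (hpos : 0 < m2 + ct p.1 p.2) : 0 < ∫ z : JCfg P j N, fibre C η w c m2 μ2 ct (fun _ => 1) p z := by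
  have hg : ExpGrowth (fun φ : Cfg P j N => Real.exp (-(p.2 * V4 w φ)) * (1 : ℝ)) :=
    expGrowth_expV_mul w hw.le hlam (ExpGrowth.const 1)
  have hint := integrable_J_mul C η w c (m2 + ct p.1 p.2) μ2 hw hpos hμ hg p.1
  have hptw : ∀ z : JCfg P j N, 0 < fibre C η w c m2 μ2 ct (fun _ => 1) p z := fun z =>
    mul_pos (mul_pos (WA_pos η w c μ2 z.1) (weight_pos _ _)) (mul_pos (Real.exp_pos _) one_pos)
  have hint' : Integrable (fun z : JCfg P j N => fibre C η w c m2 μ2 ct (fun _ => 1) p z) := hint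
  rw [integral_pos_iff_support_of_nonneg (fun z => (hptw z).le) hint']
  have hsupp : Function.support (fun z : JCfg P j N => fibre C η w c m2 μ2 ct (fun _ => 1) p z) = Set.univ :=
    Set.eq_univ_iff_forall.mpr fun z => Function.mem_support.mpr (hptw z).ne'
  rw [hsupp, Measure.volume_eq_prod, ← Set.univ_prod_univ, Measure.prod_prod]
  exact ENNReal.mul_pos (isOpen_univ.measure_pos volume Set.univ_nonempty).ne'
    (isOpen_univ.measure_pos volume Set.univ_nonempty).ne'

/-- **HEADLINE: THE TWO-POINT FUNCTION (1.19) IS JOINTLY `C^n` IN `(e, λ)` ON THE SLAB `I ×ˢ Λ`** (`I`, `Λ` convex, `Λ ⊆ [0,∞)`,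
one-sided derivatives at `λ = 0`; `ct` jointly `C^n` with `m² + ct(e,λ) > 0` on the slab) — print's *"The function G^ε has a
perturbative expansion"* (p. 416) / *"expanded into power series in e, λ"* (p. 417) read as a regularity theorem about the measure
(1.19)/(1.20) on the finite lattice: all the Taylor coefficients in `(e,λ)` exist as genuine (joint, one-sided in `λ`) derivatives, to
every order `≤ n`. [cite: Balaban1983Higgs3, (1.19)–(1.21) p.416, p.417] -/
theorem contDiffOn_twoPtCt (hw : 0 < w) (hμ : 0 < μ2) {I Λ : Set ℝ} (hI : Convex ℝ I) (hΛc : Convex ℝ Λ) (hΛ : Λ ⊆ Ici 0)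
    {ct : ℝ → ℝ → ℝ} {n : ℕ∞} (hct : ContDiff ℝ n (fun p : ℝ × ℝ => ct p.1 p.2))
    (hpos : ∀ p ∈ I ×ˢ Λ, 0 < m2 + ct p.1 p.2) (a b : Fin N) (x x' : Site P j) :
    ContDiffOn ℝ n (fun p : ℝ × ℝ => twoPtCt C η w c m2 μ2 ct p a b x x') (I ×ˢ Λ) := by
  refine (contDiffOn_integral_fibre C η w c m2 μ2 hw hμ hI hΛc hΛ hct hpos (expGrowth_legs a b x x')).div
    (contDiffOn_integral_fibre C η w c m2 μ2 hw hμ hI hΛc hΛ hct hpos (ExpGrowth.const 1)) fun p hp => ?_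
  exact (integral_fibre_one_pos C η w c m2 μ2 hw hμ (hΛ (mem_prod.1 hp).2) (hpos p hp)).ne'

end TwoPt

/-! ## §6 SLICES AND MIXED PARTIALS — v1.2: the slab lemmas of v1.0/v1.1's private §6 (`slice_snd/fst(_apply)`, `mixed_eq_append(′)`,
`mixed_comm`, `contDiffOn_slice_derivWithin`, `taylor_slab`: Coleman §4.5 / §4.1 Thm 4.3 / §5.1 Thm 5.3 within `I ×ˢ Λ`, `I` open)
are now PUBLIC and GENERAL in the tree's `Literature.Analysis.Calculus.MixedPartialDerivWithin` §6
(`iteratedDeriv_iteratedDerivWithin_slice_eq_append_openFst`, `iteratedDeriv_iteratedDerivWithin_comm_openFst`,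
`contDiffOn_iteratedDerivWithin_slice_openFst`, …; filed by this seat at the typer's request, p383793 ✓) and are used below BY
NAME; the private copies are deleted — `taylor_slab` is (v1.3) a file-local wrapper of this seat's public
`Literature.Analysis.Calculus.taylor_lagrange_mixed_partials_openFst` (`TaylorSegmentWithin` v1.1, p383971 ✓) at the base point
`(0,0)`; its tuple helper is deleted.  Every public statement of this file is unchanged. -/


section SlabTaylor

/-- **Taylor–Lagrange along the segment from `(0,0)` within the slab, in print's indexing**: for `Φ : ℝ × ℝ → ℝ` of class
`C^{k+1}` within `I ×ˢ Λ` (`I` open convex ∋ 0, `Λ` convex of unique differentiability with `0 ∈ Λ ∩ closure(interior Λ)`) and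
`(e,λ) ∈ I ×ˢ Λ` there is `θ ∈ (0,1)` with
`Φ(e,λ) = Σ_{i≤k} Σ_{α≤i} (α!(i−α)!)⁻¹e^αλ^{i−α}∂^α_e∂^{i−α}_{λ,Λ}Φ(0,0) + ((k+1)!)⁻¹D^{k+1}_{I×Λ}Φ(θe,θλ)((e,λ)^{k+1})`
— v1.3: the base point `(0,0)` case of this seat's public `Literature.Analysis.Calculus.taylor_lagrange_mixed_partials_openFst`
(`TaylorSegmentWithin` v1.1, p383971 ✓), kept as a file-local wrapper so that `twoPtCt_taylor` is unchanged. [cite: Coleman2012, §5.1 Thm. 5.3] -/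
private theorem taylor_slab {Φ : ℝ × ℝ → ℝ} {I Λ : Set ℝ} (hI : IsOpen I) (hIc : Convex ℝ I) (hΛc : Convex ℝ Λ)
    (hΛu : UniqueDiffOn ℝ Λ) (h0I : (0 : ℝ) ∈ I) (h0Λ : (0 : ℝ) ∈ Λ) (h0Λ' : (0 : ℝ) ∈ closure (interior Λ)) {k : ℕ}
    (hΦ : ContDiffOn ℝ ((k + 1 : ℕ) : WithTop ℕ∞) Φ (I ×ˢ Λ)) {e lam : ℝ} (he : e ∈ I) (hlam : lam ∈ Λ) :
    ∃ θ ∈ Ioo (0 : ℝ) 1,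
      Φ (e, lam) = ∑ i ∈ Finset.range (k + 1), ∑ α ∈ Finset.range (i + 1),
          (1 / ((α.factorial : ℝ) * ((i - α).factorial : ℝ)) * e ^ α * lam ^ (i - α)) *
            iteratedDeriv α (fun u => iteratedDerivWithin (i - α) (fun s => Φ (u, s)) Λ 0) 0
        + (((k + 1).factorial : ℝ))⁻¹ *
            iteratedFDerivWithin ℝ (k + 1) Φ (I ×ˢ Λ) (θ * e, θ * lam) (fun _ => (e, lam)) := by
  have h := Literature.Analysis.Calculus.taylor_lagrange_mixed_partials_openFst hI hIc hΛc hΛu (e₀ := 0) (t₀ := 0) h0I h0Λ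
    h0Λ' hΦ (e := e) (lam := lam) (by rwa [zero_add]) (by rwa [zero_add])
  simp only [zero_add] at h
  exact h

end SlabTaylor

section TwoPtSlices

variable {P : Params} {j N : ℕ} (C : HiggsLattice.ChargeData N) (η w c m2 μ2 : ℝ)

/-- **`e ↦ G^{ct}_{ab}(e,λ;x,x′)` IS `C^n` ON `I` AT EVERY `λ ∈ Λ`** (in particular at `λ = 0` and, for `I = ℝ`, on the whole line —
BRICK 7/10 had the first three `e`-derivatives on a ball). [cite: Balaban1983Higgs3, (1.19)–(1.21) p.416, p.417] -/
theorem contDiffOn_twoPtCt_fst (hw : 0 < w) (hμ : 0 < μ2) {I Λ : Set ℝ} (hI : Convex ℝ I) (hΛc : Convex ℝ Λ) (hΛ : Λ ⊆ Ici 0)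
    {ct : ℝ → ℝ → ℝ} {n : ℕ∞} (hct : ContDiff ℝ n (fun p : ℝ × ℝ => ct p.1 p.2))
    (hpos : ∀ p ∈ I ×ˢ Λ, 0 < m2 + ct p.1 p.2) (a b : Fin N) (x x' : Site P j) {t : ℝ} (ht : t ∈ Λ) :
    ContDiffOn ℝ n (fun e : ℝ => twoPtCt C η w c m2 μ2 ct (e, t) a b x x') I :=
  (contDiffOn_twoPtCt C η w c m2 μ2 hw hμ hI hΛc hΛ hct hpos a b x x').comp
    (contDiffOn_id.prodMk contDiffOn_const) fun _ he => ⟨he, ht⟩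

/-- **`λ ↦ G^{ct}_{ab}(e,λ;x,x′)` IS `C^n` WITHIN `Λ` AT EVERY `e ∈ I`** (one-sided at `λ = 0`).
[cite: Balaban1983Higgs3, (1.19)–(1.21) p.416, p.417] -/
theorem contDiffOn_twoPtCt_snd (hw : 0 < w) (hμ : 0 < μ2) {I Λ : Set ℝ} (hI : Convex ℝ I) (hΛc : Convex ℝ Λ) (hΛ : Λ ⊆ Ici 0)
    {ct : ℝ → ℝ → ℝ} {n : ℕ∞} (hct : ContDiff ℝ n (fun p : ℝ × ℝ => ct p.1 p.2))
    (hpos : ∀ p ∈ I ×ˢ Λ, 0 < m2 + ct p.1 p.2) (a b : Fin N) (x x' : Site P j) {e : ℝ} (he : e ∈ I) :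
    ContDiffOn ℝ n (fun s : ℝ => twoPtCt C η w c m2 μ2 ct (e, s) a b x x') Λ :=
  (contDiffOn_twoPtCt C η w c m2 μ2 hw hμ hI hΛc hΛ hct hpos a b x x').comp
    (contDiffOn_const.prodMk contDiffOn_id) fun _ hs => ⟨he, hs⟩

/-- **THE ITERATED MIXED PARTIALS ARE ENTRIES OF THE JOINT DERIVATIVE:
`∂^α_e∂^β_{λ,Λ}G^{ct}(e₀,t) = D^{α+β}_{I×Λ}G^{ct}(e₀,t)((1,0)^α,(0,1)^β)`** (`I` open, `e₀ ∈ I`, `t ∈ Λ`, `α + β ≤ n`) — for every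
index `(α,β)`; with `t = 0 ∈ Λ` these are print's coefficients `∂^{α+β}G^ε/∂e^α∂λ^β∣₀` of the *"power series in e, λ"* (p. 417), for
the WHOLE index set `2 ≤ α + 2β ≤ 4` of (1.23) and beyond, as genuine numbers. [cite: Balaban1983Higgs3, (1.21) p.416, (1.23) p.417] -/
theorem iteratedDeriv_iteratedDerivWithin_twoPtCt_eq (hw : 0 < w) (hμ : 0 < μ2) {I Λ : Set ℝ} (hIo : IsOpen I) (hI : Convex ℝ I)
    (hΛc : Convex ℝ Λ) (hΛu : UniqueDiffOn ℝ Λ) (hΛ : Λ ⊆ Ici 0) {ct : ℝ → ℝ → ℝ} {n : ℕ∞}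
    (hct : ContDiff ℝ n (fun p : ℝ × ℝ => ct p.1 p.2)) (hpos : ∀ p ∈ I ×ˢ Λ, 0 < m2 + ct p.1 p.2) (a b : Fin N)
    (x x' : Site P j) {α β : ℕ} (hαβ : ((α + β : ℕ) : ℕ∞) ≤ n) {e₀ : ℝ} (he₀ : e₀ ∈ I) {t : ℝ} (ht : t ∈ Λ) :
    iteratedDeriv α (fun e => iteratedDerivWithin β (fun s => twoPtCt C η w c m2 μ2 ct (e, s) a b x x') Λ t) e₀
      = iteratedFDerivWithin ℝ (α + β) (fun p : ℝ × ℝ => twoPtCt C η w c m2 μ2 ct p a b x x') (I ×ˢ Λ) (e₀, t)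
          (Fin.append (fun _ => ((1 : ℝ), (0 : ℝ))) (fun _ => ((0 : ℝ), (1 : ℝ)))) :=
  Literature.Analysis.Calculus.iteratedDeriv_iteratedDerivWithin_slice_eq_append_openFst (contDiffOn_twoPtCt C η w c m2 μ2 hw hμ hI hΛc hΛ hct hpos a b x x') hIo hΛu (by exact_mod_cast hαβ) he₀ ht

/-- **SCHWARZ FOR THE TWO-POINT FUNCTION: `∂^α_e∂^β_{λ,Λ}G^{ct}(e₀,t) = ∂^β_{λ,Λ}∂^α_eG^{ct}(e₀,t)`** (`I` open, `e₀ ∈ I`,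
`t ∈ Λ ∩ closure(interior Λ)` — e.g. `t = 0` for `Λ = [0,∞)` or `[0,δ]` —, `α + β ≤ n`).  In particular BRICK 10's two readings of the
index `(1,1)` — «`e` first» (§14 `hasDerivWithinAt_deriv_twoPtJoint_massCurve`) and «`λ` first» (§15
`hasDerivAt_derivWithin_twoPtJoint_affine`) — are ONE number, for every jointly smooth counterterm (not only affine in `λ`).
[cite: Balaban1983Higgs3, (1.21) p.416, (1.23) p.417] -/
theorem iteratedDeriv_iteratedDerivWithin_twoPtCt_comm (hw : 0 < w) (hμ : 0 < μ2) {I Λ : Set ℝ} (hIo : IsOpen I)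
    (hI : Convex ℝ I) (hΛc : Convex ℝ Λ) (hΛu : UniqueDiffOn ℝ Λ) (hΛ : Λ ⊆ Ici 0) {ct : ℝ → ℝ → ℝ} {n : ℕ∞}
    (hct : ContDiff ℝ n (fun p : ℝ × ℝ => ct p.1 p.2)) (hpos : ∀ p ∈ I ×ˢ Λ, 0 < m2 + ct p.1 p.2) (a b : Fin N)
    (x x' : Site P j) {α β : ℕ} (hαβ : ((α + β : ℕ) : ℕ∞) ≤ n) {e₀ : ℝ} (he₀ : e₀ ∈ I) {t : ℝ} (ht : t ∈ Λ)
    (ht' : t ∈ closure (interior Λ)) :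
    iteratedDeriv α (fun e => iteratedDerivWithin β (fun s => twoPtCt C η w c m2 μ2 ct (e, s) a b x x') Λ t) e₀
      = iteratedDerivWithin β (fun s => iteratedDeriv α (fun e => twoPtCt C η w c m2 μ2 ct (e, s) a b x x') e₀) Λ t :=
  Literature.Analysis.Calculus.iteratedDeriv_iteratedDerivWithin_comm_openFst (contDiffOn_twoPtCt C η w c m2 μ2 hw hμ hI hΛc hΛ hct hpos a b x x') hIo hΛu (by exact_mod_cast hαβ) he₀ ht ht'

/-- **`e ↦ ∂^β_{λ,Λ}G^{ct}(e,t)` IS `C^α` ON `I`** for `α + β ≤ n` (`I` open) — e.g. the right `λ`-derivative at `λ = 0⁺` is a smooth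
function of the charge (BRICK 10 §15 had its differentiability at `e = 0` for counterterms affine in `λ`).
[cite: Balaban1983Higgs3, (1.21) p.416, (1.23) p.417] -/
theorem contDiffOn_iteratedDerivWithin_twoPtCt (hw : 0 < w) (hμ : 0 < μ2) {I Λ : Set ℝ} (hIo : IsOpen I) (hI : Convex ℝ I)
    (hΛc : Convex ℝ Λ) (hΛu : UniqueDiffOn ℝ Λ) (hΛ : Λ ⊆ Ici 0) {ct : ℝ → ℝ → ℝ} {n : ℕ∞}
    (hct : ContDiff ℝ n (fun p : ℝ × ℝ => ct p.1 p.2)) (hpos : ∀ p ∈ I ×ˢ Λ, 0 < m2 + ct p.1 p.2) (a b : Fin N)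
    (x x' : Site P j) {α β : ℕ} (hαβ : ((α + β : ℕ) : ℕ∞) ≤ n) {t : ℝ} (ht : t ∈ Λ) :
    ContDiffOn ℝ α (fun e => iteratedDerivWithin β (fun s => twoPtCt C η w c m2 μ2 ct (e, s) a b x x') Λ t) I :=
  Literature.Analysis.Calculus.contDiffOn_iteratedDerivWithin_slice_openFst (contDiffOn_twoPtCt C η w c m2 μ2 hw hμ hI hΛc hΛ hct hpos a b x x') hIo hΛu
    (by exact_mod_cast hαβ) ht

/-- **THE TWO-VARIABLE TAYLOR FORMULA OF (1.19) WITH LAGRANGE REMAINDER, IN PRINT'S INDEXING** (p. 417: *"expanded into power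
series in e, λ … δm² = Σ_{2≤α+2β≤4}e^αλ^βδm²_{(α,β)}"*): for `ct` jointly `C^{k+1}` and `(e,λ)` in the slab (`I` open convex ∋ 0,
`Λ ∋ 0` convex, `0 ∈ closure(interior Λ)` — e.g. `Λ = [0,∞)`) there is `θ ∈ (0,1)` with
`G^{ct}(e,λ) = Σ_{i≤k}Σ_{α≤i}(α!(i−α)!)⁻¹e^αλ^{i−α}·∂^α_e∂^{i−α}_{λ,Λ}G^{ct}(0,0) + ((k+1)!)⁻¹D^{k+1}_{I×Λ}G^{ct}(θe,θλ)((e,λ)^{k+1})` —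
every coefficient a genuine iterated one-sided mixed partial (§6), the remainder an explicit within-derivative; EVERY order `k`.
(The VALUES of the coefficients of weight `α+2β ≤ 3` are BRICKS 7/8/10; weight 4 enters here as EXISTENCE only.)
[cite: Balaban1983Higgs3, (1.21) p.416, (1.23) p.417] -/
theorem twoPtCt_taylor (hw : 0 < w) (hμ : 0 < μ2) {I Λ : Set ℝ} (hIo : IsOpen I) (hI : Convex ℝ I) (hΛc : Convex ℝ Λ)
    (hΛu : UniqueDiffOn ℝ Λ) (hΛ : Λ ⊆ Ici 0) (h0I : (0 : ℝ) ∈ I) (h0Λ : (0 : ℝ) ∈ Λ) (h0Λ' : (0 : ℝ) ∈ closure (interior Λ))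
    {ct : ℝ → ℝ → ℝ} {k : ℕ} (hct : ContDiff ℝ ((k + 1 : ℕ) : ℕ∞) (fun p : ℝ × ℝ => ct p.1 p.2))
    (hpos : ∀ p ∈ I ×ˢ Λ, 0 < m2 + ct p.1 p.2) (a b : Fin N) (x x' : Site P j) {e lam : ℝ} (he : e ∈ I) (hlam : lam ∈ Λ) :
    ∃ θ ∈ Ioo (0 : ℝ) 1,
      twoPtCt C η w c m2 μ2 ct (e, lam) a b x x'
        = ∑ i ∈ Finset.range (k + 1), ∑ α ∈ Finset.range (i + 1),
            (1 / ((α.factorial : ℝ) * ((i - α).factorial : ℝ)) * e ^ α * lam ^ (i - α)) *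
              iteratedDeriv α (fun u => iteratedDerivWithin (i - α) (fun s => twoPtCt C η w c m2 μ2 ct (u, s) a b x x') Λ 0) 0
          + (((k + 1).factorial : ℝ))⁻¹ *
              iteratedFDerivWithin ℝ (k + 1) (fun p : ℝ × ℝ => twoPtCt C η w c m2 μ2 ct p a b x x') (I ×ˢ Λ)
                (θ * e, θ * lam) (fun _ => (e, lam)) :=
  taylor_slab hIo hI hΛc hΛu h0I h0Λ h0Λ' (contDiffOn_twoPtCt C η w c m2 μ2 hw hμ hI hΛc hΛ
    (by exact_mod_cast hct) hpos a b x x') he hlam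

end TwoPtSlices

/-! ## §7 COROLLARIES FOR BRICK 7's FAMILY (no counterterm): (1.19) at `λ ≥ 0` is jointly `C^∞` on `ℝ × [0,∞)`, and BRICK 7's
`twoPt` is `C^∞` on the whole real line -/

section NoCounterterm

variable {P : Params} {j N : ℕ} (C : HiggsLattice.ChargeData N) (η w c m2 μ2 : ℝ)

/-- **(1.19) WITHOUT COUNTERTERM IS JOINTLY `C^∞` IN `(e,λ) ∈ ℝ × [0,∞)`** (one-sided at `λ = 0`).
[cite: Balaban1983Higgs3, (1.19)–(1.21) p.416] -/
theorem contDiffOn_twoPtCt_zero (hw : 0 < w) (hm : 0 < m2) (hμ : 0 < μ2) (a b : Fin N) (x x' : Site P j) :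
    ContDiffOn ℝ (⊤ : ℕ∞) (fun p : ℝ × ℝ => twoPtCt C η w c m2 μ2 (fun _ _ => 0) p a b x x') (univ ×ˢ Ici 0) :=
  contDiffOn_twoPtCt C η w c m2 μ2 hw hμ convex_univ (convex_Ici 0) Subset.rfl (n := ⊤) contDiff_const
    (fun p _ => by rw [add_zero]; exact hm) a b x x'

/-- **BRICK 7's TWO-POINT FUNCTION `e ↦ G_{e,ab}(x,x′)` IS `C^∞` ON ALL OF `ℝ`** (BRICK 7 §6 / BRICK 10 §4 had its first three
derivatives, on a ball): every `e`-Taylor coefficient `∂^α_eG(0)/α!` of (1.19) exists; the odd ones vanish by BRICK 10's reflection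
`A ↦ −A` (`B3Eq123RenormalizationConditions.iteratedDeriv_odd_twoPt_massCurve`), `α = 2` is BRICK 7's Wick evaluation ② + ④.
[cite: Balaban1983Higgs3, (1.19)–(1.22) p.416] -/
theorem contDiff_twoPt (hw : 0 < w) (hm : 0 < m2) (hμ : 0 < μ2) (a b : Fin N) (x x' : Site P j) :
    ContDiff ℝ (⊤ : ℕ∞) (fun e : ℝ => twoPt C η w c m2 μ2 e a b x x') := by
  have h := contDiffOn_twoPtCt_fst C η w c m2 μ2 hw hμ convex_univ (convex_Ici 0) Subset.rfl (n := ⊤)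
    (ct := fun _ _ => 0) contDiff_const (fun p _ => by rw [add_zero]; exact hm) a b x x' (t := 0) Set.self_mem_Ici
  rw [← contDiffOn_univ]
  refine h.congr fun e _ => ?_
  exact (twoPtCt_zero_zero C η w c m2 μ2 e a b x x').symm

/-- **THE `e`-TAYLOR FORMULA OF BRICK 7's `twoPt` TO EVERY ORDER** (`λ = 0`, no counterterm): for every `k` and `e` there is `θ ∈ (0,1)`
with `G_e = Σ_{α≤k}(α!)⁻¹e^α∂^α_eG(0) + ((k+1)!)⁻¹e^{k+1}∂^{k+1}_eG(θe)` (Mathlib's `taylor_mean_remainder_lagrange` made available by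
`contDiff_twoPt`). [cite: Balaban1983Higgs3, (1.19)–(1.22) p.416] -/
theorem twoPt_taylor (hw : 0 < w) (hm : 0 < m2) (hμ : 0 < μ2) (a b : Fin N) (x x' : Site P j) (k : ℕ) {e : ℝ} (he : 0 < e) :
    ∃ θ ∈ Ioo (0 : ℝ) e,
      twoPt C η w c m2 μ2 e a b x x'
        = ∑ α ∈ Finset.range (k + 1), ((α.factorial : ℝ))⁻¹ * e ^ α * iteratedDeriv α (fun u => twoPt C η w c m2 μ2 u a b x x') 0
          + iteratedDeriv (k + 1) (fun u => twoPt C η w c m2 μ2 u a b x x') θ * e ^ (k + 1) / ((k + 1).factorial : ℝ) := by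
  set f : ℝ → ℝ := fun u => twoPt C η w c m2 μ2 u a b x x' with hf
  have hF : ContDiff ℝ (⊤ : ℕ∞) f := contDiff_twoPt C η w c m2 μ2 hw hm hμ a b x x'
  have hwithin : ∀ (m : ℕ) {u : ℝ}, u ∈ Icc (0 : ℝ) e → iteratedDerivWithin m f (Icc 0 e) u = iteratedDeriv m f u :=
    fun m u hu => iteratedDerivWithin_eq_iteratedDeriv (uniqueDiffOn_Icc he) (hF.contDiffAt.of_le (by exact_mod_cast le_top)) hu
  have hfk : ContDiffOn ℝ (k : WithTop ℕ∞) f (uIcc 0 e) := by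
    rw [uIcc_of_le he.le]; exact (hF.of_le (by exact_mod_cast le_top)).contDiffOn
  have hf' : DifferentiableOn ℝ (iteratedDerivWithin k f (uIcc 0 e)) (uIoo 0 e) := by
    rw [uIcc_of_le he.le, uIoo_of_le he.le]
    have hdiff : Differentiable ℝ (iteratedDeriv k f) := hF.differentiable_iteratedDeriv k (by exact_mod_cast ENat.coe_lt_top k)
    refine (hdiff.differentiableOn.mono Ioo_subset_Icc_self).congr fun u hu => hwithin k (Ioo_subset_Icc_self hu)
  obtain ⟨θ, hθ, hrem⟩ := taylor_mean_remainder_lagrange (f := f) (x₀ := 0) (x := e) (n := k) he.ne hfk hf'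
  rw [uIoo_of_le he.le] at hθ
  rw [uIcc_of_le he.le, taylor_within_apply, sub_zero] at hrem
  refine ⟨θ, hθ, ?_⟩
  have hθI : θ ∈ Icc (0 : ℝ) e := Ioo_subset_Icc_self hθ
  have hsum : ∑ α ∈ Finset.range (k + 1), ((α.factorial : ℝ)⁻¹ * e ^ α) • iteratedDerivWithin α f (Icc 0 e) 0
      = ∑ α ∈ Finset.range (k + 1), ((α.factorial : ℝ))⁻¹ * e ^ α * iteratedDeriv α f 0 := by
    refine Finset.sum_congr rfl fun α _ => ?_
    rw [smul_eq_mul, hwithin α ⟨le_rfl, he.le⟩]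
  rw [hsum, hwithin (k + 1) hθI] at hrem
  have e1 : f e = twoPt C η w c m2 μ2 e a b x x' := rfl
  rw [← e1]
  linarith [hrem]

end NoCounterterm





/-! ## §8 (v1.1) THE DOUBLE TAYLOR POLYNOMIAL OF (1.19) IS PART I's ONE-SIDED PERTURBATIVE SUM (I.3.36)/(I.3.62) EVALUATED AT `G^{ct}`:
for counterterms positive on a full slab `ℝ × [0,δ]` (r12's decl of record `B1Sect3Statements.pertSum362R` =
`Σ_{0≤α+β≤n̄}(α!β!)⁻¹e^αλ^β∂^α_e[∂^β_{λ,[0,∞)}E(e,·)(0)](0)`, the typer's generic `B1Eq362TaylorRemainder` BY NAME) -/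

section PertSum

variable {P : Params} {j N : ℕ} (C : HiggsLattice.ChargeData N) (η w c m2 μ2 : ℝ)

/-- **(1.19) = [B1's PERTURBATIVE SUM (I.3.62) OF `G^{ct}` TO ORDER `n̄`] + LAGRANGE REMAINDER**: for `ct` jointly `C^{n̄+1}` with
`m² + ct(e,λ) > 0` for all `e` and `λ ∈ [0,δ]` (`δ > 0`), at every `(e,λ) ∈ ℝ × [0,δ]` there is `θ ∈ (0,1)` with
`G^{ct}(e,λ) = Σ_{0≤α+β≤n̄}(α!β!)⁻¹e^αλ^β∂^α_e∂^β_{λ,+}G^{ct}(0,0) + ((n̄+1)!)⁻¹D^{n̄+1}_{ℝ×[0,δ]}G^{ct}(θe,θλ)((e,λ)^{n̄+1})` — the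
*"power series in e, λ"* of p. 417 truncated *"until the order n̄"* in the words and the shape of part I (p. 624, (I.3.36)/(I.3.62)).
[cite: Balaban1983Higgs3, (1.21) p.416, (1.23) p.417; Balaban1982Higgs1, (3.62) p.624] -/
theorem twoPtCt_eq_pertSum362R_add_remainder (hw : 0 < w) (hμ : 0 < μ2) {δ : ℝ} (hδ : 0 < δ) {ct : ℝ → ℝ → ℝ} {nbar : ℕ}
    (hct : ContDiff ℝ ((nbar + 1 : ℕ) : ℕ∞) (fun p : ℝ × ℝ => ct p.1 p.2))
    (hpos : ∀ p ∈ (univ ×ˢ Icc 0 δ : Set (ℝ × ℝ)), 0 < m2 + ct p.1 p.2) (a b : Fin N) (x x' : Site P j) {e lam : ℝ}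
    (hlam : lam ∈ Icc (0 : ℝ) δ) :
    ∃ θ ∈ Ioo (0 : ℝ) 1,
      twoPtCt C η w c m2 μ2 ct (e, lam) a b x x'
        = B1Sect3Statements.pertSum362R (fun e' l' => twoPtCt C η w c m2 μ2 ct (e', l') a b x x') e lam nbar
          + (((nbar + 1).factorial : ℝ))⁻¹ *
              iteratedFDerivWithin ℝ (nbar + 1) (fun p : ℝ × ℝ => twoPtCt C η w c m2 μ2 ct (p.1, p.2) a b x x') (univ ×ˢ Icc 0 δ)
                (θ * e, θ * lam) (fun _ => (e, lam)) :=
  B1Eq362TaylorRemainder.eq_pertSum362R_add_remainder (E := fun e' l' => twoPtCt C η w c m2 μ2 ct (e', l') a b x x') hδ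
    (contDiffOn_twoPtCt C η w c m2 μ2 hw hμ convex_univ (convex_Icc 0 δ) (fun _ hl => hl.1) (by exact_mod_cast hct) hpos a b x x')
    hlam

/-- **`G^{ct}(e,λ) = pertSum362R(G^{ct})(e,λ,n̄) + O(‖(e,λ)‖^{n̄+1})` UNIFORMLY ON BOXES `[−R,R] × [0,δ]`** (continuity of the
`(n̄+1)`-st within-derivative on the compact box; `B1Eq362TaylorRemainder.exists_abs_sub_pertSum362R_le`).
[cite: Balaban1983Higgs3, (1.21) p.416, (1.23) p.417; Balaban1982Higgs1, (3.62) p.624] -/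
theorem exists_abs_twoPtCt_sub_pertSum362R_le (hw : 0 < w) (hμ : 0 < μ2) {δ : ℝ} (hδ : 0 < δ) {ct : ℝ → ℝ → ℝ} {nbar : ℕ}
    (hct : ContDiff ℝ ((nbar + 1 : ℕ) : ℕ∞) (fun p : ℝ × ℝ => ct p.1 p.2))
    (hpos : ∀ p ∈ (univ ×ˢ Icc 0 δ : Set (ℝ × ℝ)), 0 < m2 + ct p.1 p.2) (a b : Fin N) (x x' : Site P j) (R : ℝ) :
    ∃ Cst : ℝ, ∀ e ∈ Icc (-R) R, ∀ lam ∈ Icc (0 : ℝ) δ,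
      |twoPtCt C η w c m2 μ2 ct (e, lam) a b x x'
          - B1Sect3Statements.pertSum362R (fun e' l' => twoPtCt C η w c m2 μ2 ct (e', l') a b x x') e lam nbar|
        ≤ Cst * ‖((e, lam) : ℝ × ℝ)‖ ^ (nbar + 1) :=
  B1Eq362TaylorRemainder.exists_abs_sub_pertSum362R_le (E := fun e' l' => twoPtCt C η w c m2 μ2 ct (e', l') a b x x') hδ
    (contDiffOn_twoPtCt C η w c m2 μ2 hw hμ convex_univ (convex_Icc 0 δ) (fun _ hl => hl.1) (by exact_mod_cast hct) hpos a b x x') R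

/-- the no-counterterm instance: **the two-point function (1.19) at `(e,λ)` equals B1's perturbative sum of itself to order `n̄` plus
`O(‖(e,λ)‖^{n̄+1})` uniformly on `[−R,R] × [0,δ]`**, for every `n̄`, `R`, `δ > 0` (`m² > 0`).
[cite: Balaban1983Higgs3, (1.21) p.416; Balaban1982Higgs1, (3.62) p.624] -/
theorem exists_abs_twoPtCt_zero_sub_pertSum362R_le (hw : 0 < w) (hm : 0 < m2) (hμ : 0 < μ2) {δ : ℝ} (hδ : 0 < δ) (nbar : ℕ)
    (a b : Fin N) (x x' : Site P j) (R : ℝ) :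
    ∃ Cst : ℝ, ∀ e ∈ Icc (-R) R, ∀ lam ∈ Icc (0 : ℝ) δ,
      |twoPtCt C η w c m2 μ2 (fun _ _ => 0) (e, lam) a b x x'
          - B1Sect3Statements.pertSum362R (fun e' l' => twoPtCt C η w c m2 μ2 (fun _ _ => 0) (e', l') a b x x') e lam nbar|
        ≤ Cst * ‖((e, lam) : ℝ × ℝ)‖ ^ (nbar + 1) :=
  exists_abs_twoPtCt_sub_pertSum362R_le C η w c m2 μ2 hw hμ hδ (ct := fun _ _ => 0) contDiff_const
    (fun p _ => by rw [add_zero]; exact hm) a b x x' R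

end PertSum

/-! ## §9 (v1.1) CHARGE CONJUGATION AND THE ODD ORDERS: `G^{ct}(−e,λ) = G^{ct}(e,λ)` for an `e`-even counterterm (the reflection
`A ↦ −A`, as in BRICK 10 §13 — here for this file's `twoPtCt`, so that no import of the unbuilt BRICK 10 is needed), hence EVERY
coefficient `∂^α_e∂^β_{λ,Λ}G^{ct}(0,t)` with `α` odd vanishes: print's index set `{2 ≤ α+2β ≤ 4}` of (1.23) lists only even `α` -/

section Parity

variable {P : Params} {j N : ℕ} (C : HiggsLattice.ChargeData N) (η w c m2 μ2 : ℝ)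

omit C η w c m2 μ2 in
/-- the reflection `(A,φ) ↦ (−A,φ)` preserves `dA dφ` (sitewise `−1 ∈ O(d)` on the vector field): `∫g(−A,φ) = ∫g(A,φ)`. [folklore] -/
private theorem integral_comp_reflectA (g : JCfg P j N → ℝ) :
    ∫ z : JCfg P j N, g (-z.1, z.2) = ∫ z : JCfg P j N, g z := by
  have hA : MeasurePreserving (fun A : Cfg P j P.d => -A) volume volume :=
    volume_preserving_pi (α' := fun _ : Site P j => EuclideanSpace ℝ (Fin P.d))
      (β' := fun _ : Site P j => EuclideanSpace ℝ (Fin P.d)) (f := fun _ v => -v)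
      fun _ => (LinearIsometryEquiv.neg ℝ (E := EuclideanSpace ℝ (Fin P.d))).measurePreserving
  have he : MeasurePreserving ((MeasurableEquiv.neg (Cfg P j P.d)).prodCongr (MeasurableEquiv.refl (Cfg P j N)))
      (volume : Measure (JCfg P j N)) (volume : Measure (JCfg P j N)) :=
    hA.prod (MeasurePreserving.id (volume : Measure (Cfg P j N)))
  exact he.integral_comp' g

/-- **charge conjugation on the integrand**: `[e^{−S^ε}e^{−λV}F]_{−e, ct}(A,φ) = [e^{−S^ε}e^{−λV}F]_{e, ct(−·,·)}(−A,φ)`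
(`U_{−e}(A_b) = U_e((−A)_b)`; the vector Gaussian of (1.20) is even in `A`). [cite: Balaban1983Higgs3, (1.19)–(1.20) p.416] -/
theorem fibre_neg_charge (ct : ℝ → ℝ → ℝ) (F : Cfg P j N → ℝ) (e lam : ℝ) (z : JCfg P j N) :
    fibre C η w c m2 μ2 ct F (-e, lam) z = fibre C η w c m2 μ2 (fun e' l' => ct (-e') l') F (e, lam) (-z.1, z.2) := by
  have htoVec : toVec (-z.1) = -toVec z.1 := by
    funext b
    rw [Pi.neg_apply, toVec_apply, toVec_apply, Pi.neg_apply, inner_neg_left]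
  have hWA : WA η w c μ2 (-z.1) = WA η w c μ2 z.1 := by
    unfold WA weight quadForm covLaplaceForm covDerivScalar massForm
    simp only [HiggsLattice.ChargeData.Urep_apply, Pi.zero_apply, HiggsLattice.ChargeData.U_zero, Pi.neg_apply,
      one_apply_eq_self, norm_neg, ← neg_sub', smul_neg]
  have hwt : ∀ (M : ℝ) (A : VecField P j ℝ) (φ : Cfg P j N),
      weight (Ce C (-e)) η w c M A φ = weight (Ce C e) η w c M (-A) φ := by
    intro M A φ
    unfold weight quadForm covLaplaceForm covDerivScalar
    simp only [HiggsLattice.ChargeData.Urep_apply, Ce_U, Pi.neg_apply, mul_neg, neg_mul]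
  unfold fibre J
  dsimp only
  rw [hWA, hwt, htoVec]

/-- **`G^{ct}` IS EVEN IN THE CHARGE for an `e`-even counterterm**: `G^{ct}_{ab}(−e,λ;x,x′) = G^{ct}_{ab}(e,λ;x,x′)` (BRICK 10's
`twoPtJoint_neg_charge`, for this file's `twoPtCt`). [cite: Balaban1983Higgs3, (1.19)–(1.20) p.416] -/
theorem twoPtCt_neg_charge {ct : ℝ → ℝ → ℝ} (hct : ∀ e l, ct (-e) l = ct e l) (e lam : ℝ) (a b : Fin N) (x x' : Site P j) :
    twoPtCt C η w c m2 μ2 ct (-e, lam) a b x x' = twoPtCt C η w c m2 μ2 ct (e, lam) a b x x' := by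
  have hct' : (fun e' l' => ct (-e') l') = ct := by
    funext e' l'; exact hct e' l'
  unfold twoPtCt
  simp_rw [fibre_neg_charge, hct']
  rw [integral_comp_reflectA (fun z => fibre C η w c m2 μ2 ct (legs a b x x') (e, lam) z),
    integral_comp_reflectA (fun z => fibre C η w c m2 μ2 ct (fun _ => 1) (e, lam) z)]

omit C η w c m2 μ2 in
/-- the derivative of an even real function is odd, of an odd one even (Mathlib's total `deriv`). [folklore] -/
private theorem deriv_reflect {f : ℝ → ℝ} (σ : ℝ) (hσ : σ = 1 ∨ σ = -1) (hf : ∀ s, f (-s) = σ * f s) (s : ℝ) :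
    deriv f (-s) = -σ * deriv f s := by
  have h := deriv_comp_neg f s
  have hfe : (fun x => f (-x)) = fun x => σ * f x := funext hf
  rw [hfe, deriv_const_mul_field] at h
  rcases hσ with rfl | rfl <;> linarith

omit C η w c m2 μ2 in
/-- the even-order derivatives of an even function are even functions. [folklore] -/
private theorem iteratedDeriv_two_mul_reflect {f : ℝ → ℝ} (hf : ∀ s, f (-s) = f s) (k : ℕ) (s : ℝ) :
    iteratedDeriv (2 * k) f (-s) = iteratedDeriv (2 * k) f s := by
  induction k generalizing s with
  | zero => simpa using hf s
  | succ k ih =>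
    have h2 : 2 * (k + 1) = 2 * k + 1 + 1 := by ring
    rw [h2, iteratedDeriv_succ, iteratedDeriv_succ]
    have h1 : ∀ s, deriv (iteratedDeriv (2 * k) f) (-s) = -1 * deriv (iteratedDeriv (2 * k) f) s :=
      fun s => by simpa using deriv_reflect 1 (Or.inl rfl) (fun s => by rw [one_mul]; exact ih s) s
    have := deriv_reflect (-1) (Or.inr rfl) h1 s
    simpa using this

omit C η w c m2 μ2 in
/-- **the odd-order derivatives at `0` of an even function vanish.** [folklore] -/
private theorem iteratedDeriv_odd_at_zero_of_even {f : ℝ → ℝ} (hf : ∀ s, f (-s) = f s) (k : ℕ) :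
    iteratedDeriv (2 * k + 1) f 0 = 0 := by
  rw [iteratedDeriv_succ]
  have h := deriv_reflect 1 (Or.inl rfl) (fun s => by rw [one_mul]; exact iteratedDeriv_two_mul_reflect hf k s) 0
  rw [neg_zero] at h
  linarith

/-- **EVERY COEFFICIENT WITH AN ODD POWER OF `e` VANISHES**: for an `e`-even counterterm, every `λ`-set `Λ`, every `t`, every
`β` and every `k`, `∂^{2k+1}_e[∂^β_{λ,Λ}G^{ct}(e,·)(t)](0) = 0` (in Mathlib's total derivatives; their EXISTENCE on a slab is §6).  With
`t = 0`: the coefficients `(α,β)` of the double expansion of (1.19) with `α` odd are all zero — which is why the index set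
`2 ≤ α+2β ≤ 4` of (1.23) consists of `(2,0), (0,1), (4,0), (2,1), (0,2)` only; at weight 3 this is referee D-g79-2's statement (the
order-`e³` ∕ `e¹λ¹` coefficients of the FULL two-point function vanish; the 1PI letters of (1.21) are not extracted).
[cite: Balaban1983Higgs3, (1.21) p.416, (1.23) p.417] -/
theorem iteratedDeriv_odd_iteratedDerivWithin_twoPtCt_eq_zero {ct : ℝ → ℝ → ℝ} (hct : ∀ e l, ct (-e) l = ct e l)
    (a b : Fin N) (x x' : Site P j) (Λ : Set ℝ) (t : ℝ) (β k : ℕ) :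
    iteratedDeriv (2 * k + 1) (fun e => iteratedDerivWithin β (fun s => twoPtCt C η w c m2 μ2 ct (e, s) a b x x') Λ t) 0 = 0 := by
  refine iteratedDeriv_odd_at_zero_of_even (fun e => ?_) k
  have hfun : (fun s => twoPtCt C η w c m2 μ2 ct (-e, s) a b x x') = fun s => twoPtCt C η w c m2 μ2 ct (e, s) a b x x' :=
    funext fun s => twoPtCt_neg_charge C η w c m2 μ2 hct e s a b x x'
  rw [hfun]

/-- the `β = 0` case in plain form: `∂^{2k+1}_eG^{ct}(·,λ)(0) = 0` at every `λ`. [cite: Balaban1983Higgs3, (1.21) p.416, (1.23) p.417] -/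
theorem iteratedDeriv_odd_twoPtCt_eq_zero {ct : ℝ → ℝ → ℝ} (hct : ∀ e l, ct (-e) l = ct e l) (a b : Fin N) (x x' : Site P j)
    (lam : ℝ) (k : ℕ) :
    iteratedDeriv (2 * k + 1) (fun e => twoPtCt C η w c m2 μ2 ct (e, lam) a b x x') 0 = 0 :=
  iteratedDeriv_odd_at_zero_of_even (fun e => twoPtCt_neg_charge C η w c m2 μ2 hct e lam a b x x') k

end Parity

end Literature.MathematicalPhysics.QuantumFieldTheory.Balaban1983to89.B3Eq119JointSmooth

end
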